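import Literature.Probability.LatticeModels.NVectorInfraredBound
import Literature.Probability.LatticeModels.GaussianDominationProofs
import HarnessLib

/-!
# The infrared bound for `ν`-vector models, proved (Friedli–Velenik 2017, Thm. 10.24)

Sibling proof file of `Literature.Probability.LatticeModels.NVectorInfraredBound`, which vendors
the named fact `FriedliVelenik2017_nVector_infraredBound` (infrared bound
`|𝕋_L|⁻¹⟨‖∑_x e^{-ip·x}S_x‖²⟩_{L;β} ≤ ν/(4βε(p))`, `p ≠ 0`, and the finite-volume long-range-order
bound `⟨‖m_L‖²⟩_{L;β} ≥ 1 - (ν/4β)|𝕋_L|⁻¹∑_{p≠0} ε(p)⁻¹` for unit spins) for the `ν`-component models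
(10.38) on the torus `(ℤ/Lℤ)^d`, `L` even, `L ≥ 4`, with an arbitrary nonzero finite compactly
supported single-spin measure `ρ` on `ℝ^ν` and `β > 0`. Here the fact is **discharged**:
`Literature.Probability.LatticeModels.FriedliVelenik2017_nVector_infraredBound_holds`.

## Source and proof architecture

S. Friedli, Y. Velenik, *Statistical Mechanics of Lattice Systems*, CUP (2017), §10.5
(PDF pp. 499–507, read): Thm. 10.24 (p. 502), §10.5.3 Prop. 10.27 (Gaussian domination, p. 503),
Lemma 10.28 (p. 504), proof of Prop. 10.27 (p. 505), proof of Thm. 10.24 (pp. 506–507), and the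
displays (10.39)–(10.40) of §10.5.2 (p. 501) for the long-range-order clause. The file follows
the printed proof, in the integral (measure-theoretic) form required by a general `ρ`; it is the
`ν`-component, general-`ρ` analogue of the tree's Ising files `GaussianDomination.lean` /
`GaussianDominationProofs.lean`, whose finite-graph reflection geometry
(`sum_edgeFinset_reflect_split`, `crossSites`, `innerEdges`), torus geometry
(`Torus.reflectBetweenSites`, `Torus.halfBetweenSites`, `Torus.eq_reflectBetweenSites_of_adj`, …),
bond forms (`gradForm`, `gradFormC`, `gradNormSq_torusChar`) and edge parametrisation
(`sum_edgeFinset_torusGraph`) are reused.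

1. **Lemma 10.28** (`NVector.kerInt_sq_le`): for a finite measure `m`, bounded measurable
   `Φ, Ψ` and features `p_c, q_c`, and `β ≥ 0`,
   `(∫∫ Φ(τ)Ψ(τ')e^{β∑_c p_c(τ)q_c(τ')} dm dm)² ≤ (∫∫ ΦΦ e^{β∑pp})(∫∫ ΨΨ e^{β∑qq})`. As printed:
   expand the exponential ((10.44); here its Taylor polynomials, `NVector.kerIntN_eq_sum`, each
   term factorising over the two halves by Fubini), Cauchy–Schwarz termwise and in `n`
   (`NVector.truncated_cauchySchwarz`, discriminant form), and resum (dominated convergence,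
   `NVector.tendsto_kerIntN`).
2. **Proof of Prop. 10.27, splitting** (`NVector.exponent_split`, `NVector.vZ_eq_pairInt`): for a
   reflection `θ` of a finite graph with positive half `𝕋₊`,
   `-β∑‖ω_i - ω_j + h_i - h_j‖² = A + Θ(B) + ∑_{i'} C_{i'}·Θ(D_{i'})` with the printed `A, B, C, D`
   (`NVector.halfExp`), and `Z(h) = ∫∫ e^{A}e^{Θ B}e^{∑CΘD}` over pairs of half configurations, the
   map `ω ↦ (ω|_{𝕋₊}, (ω∘θ)|_{𝕋₊})` sending `⊗_V ρ` to `(⊗_{𝕋₊}ρ) ⊗ (⊗_{𝕋₊}ρ)`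
   (`NVector.measurePreserving_splitEquiv`, the reflection positivity of `μ₀`, Lemma 10.7). Hence
   **`Z(h)² ≤ Z(h⁺)Z(h⁻)`** (`NVector.vZ_sq_le_reflect`).
3. **Proof of Prop. 10.27, descent** (`NVector.vZ_le_vZ_zero`): a maximiser of `Z` with minimal
   number `N(h)` of bad bonds has `N = 0`, by reflecting through the plane bisecting a bad bond;
   hence `Z(h) ≤ Z(0)` on the even torus, `L ≥ 4`. (Deviation, as in the Ising file: the maximiser
   is taken over the finite set of fields with values in the range of `h` — Kennedy–Lieb–Shastry's
   finite descent — instead of the printed compactness argument.)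
4. **(10.46)–(10.47)** (`NVector.integral_weight_vecGradForm_sq_le`):
   `2β ∫ e^{-β𝓔(ω)}𝓔(ω,h)² dμ₀ ≤ 𝓔(h,h) Z(0)`. (Deviation: instead of differentiating `Z(λh)` twice
   we use `Z(th) + Z(-th) ≤ 2Z(0)` and `e^x + e^{-x} ≥ 2 + x²`, then the first-order expansion in
   `t²`; no symmetry of `ρ` is needed.)
5. **Plane waves** (`NVector.gradFormC_torusChar_fun`, `NVector.weighted_mode_bound`): for
   `h_j = e^{ip·j}e_a` (real and imaginary parts), `𝓔(ω,h) = 2ε(p)∑_x ω_x^a e^{ip·x}` and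
   `∑‖h_i - h_j‖² = 2|𝕋_L|ε(p)` with `ε(p) = ∑ᵢ(1 - cos pᵢ) = d{1 - (2d)⁻¹∑_{j∼0}cos(p·j)}`, whence
   `⟨|∑_x S_x^a e^{ip·x}|²⟩ ≤ |𝕋_L|/(4βε(p))`; summing over `a` gives clause (1)
   (Gibbs expectations are `e^{-ℋ}`-weighted `μ₀`-averages, `NVector.integral_nVectorGibbs`, and
   `ℋ = β𝓔(ω,ω)`, `NVector.nVectorHamiltonian_eq_vecGradForm`). The translation-invariance
   rewriting `⟨‖Ŝ_p‖²⟩ = ∑_j e^{ip·j}⟨S_0·S_j⟩` of the book is not needed: the fact is stated for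
   `⟨‖Ŝ_p‖²⟩` directly.
6. **(10.39)–(10.40)** (`NVector.magnetisationNormSq_eq`): for unit spins, Plancherel
   (`torusFourier_plancherel_holds`) gives `‖m_L‖² = 1 - |𝕋_L|⁻²∑_{p≠0}‖∑_x e^{-ip·x}S_x‖²` a.s.,
   and clause (2) follows from clause (1).

## Mathlib / tree status

No reflection positivity, Gaussian domination or infrared bound in Mathlib. Anchors:
`MeasureTheory.measurePreserving_piEquivPiSubtypeProd`, `MeasureTheory.measurePreserving_piCongrLeft`,
`MeasurePreserving.prod`, `MeasurePreserving.integral_comp'`, `MeasureTheory.integral_prod_mul`,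
`Integrable.mul_prod`, `tendsto_integral_of_dominated_convergence`,
`NormedSpace.expSeries_div_hasSum_exp`, `Measure.tendsto_eval_ae_ae`,
`integral_withDensity_eq_integral_toReal_smul`, `integral_exp_pos`, `discrim_le_zero`,
`Finset.exists_max_image` / `Finset.exists_min_image`.

## References

* S. Friedli, Y. Velenik, *Statistical Mechanics of Lattice Systems: A Concrete Mathematical
  Introduction*, Cambridge University Press (2017), doi:10.1017/9781316882603, §10.5:
  (10.38)–(10.47), Thm. 10.24, Prop. 10.27, Lemma 10.28. [FriedliVelenik2017]
* J. Fröhlich, B. Simon, T. Spencer, *Infrared bounds, phase transitions and continuous symmetry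
  breaking*, Comm. Math. Phys. 50 (1976) 79–95, Thm. 3.1. [FrohlichSimonSpencer1976]
* T. Kennedy, E. H. Lieb, B. S. Shastry, *Existence of Néel order in some spin-1/2 Heisenberg
  antiferromagnets*, J. Stat. Phys. 53 (1988) 1019–1030, p. 1029 (finite descent).
-/

noncomputable section

open MeasureTheory Filter Topology Finset
open scoped Real

namespace Literature.Probability.LatticeModels

namespace NVector

/-! ### Lemma 10.28: a Cauchy–Schwarz inequality for exponential kernels (integral form) -/

section ExpKernelIntegral

variable {T : Type*} [MeasurableSpace T] {C : Type*} [Fintype C]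

/-- The Taylor polynomial `∑_{n<N} xⁿ/n!` of the exponential. [folklore] -/
def expTaylor (N : ℕ) (x : ℝ) : ℝ := ∑ n ∈ Finset.range N, x ^ n / (n.factorial : ℝ)

/-- The Taylor polynomials of `exp` converge (the exponential series, Mathlib's
`NormedSpace.expSeries_div_hasSum_exp`). [folklore] -/
theorem tendsto_expTaylor (x : ℝ) : Tendsto (fun N => expTaylor N x) atTop (𝓝 (Real.exp x)) := by
  have h : HasSum (fun n : ℕ => x ^ n / (n.factorial : ℝ)) (Real.exp x) := by
    rw [Real.exp_eq_exp_ℝ]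
    exact NormedSpace.expSeries_div_hasSum_exp _
  exact h.tendsto_sum_nat

/-- `|∑_{n<N} xⁿ/n!| ≤ e^{|x|}`. [folklore] -/
theorem abs_expTaylor_le (N : ℕ) (x : ℝ) : |expTaylor N x| ≤ Real.exp |x| := by
  unfold expTaylor
  calc |∑ n ∈ Finset.range N, x ^ n / (n.factorial : ℝ)|
      ≤ ∑ n ∈ Finset.range N, |x ^ n / (n.factorial : ℝ)| := Finset.abs_sum_le_sum_abs _ _
    _ = ∑ n ∈ Finset.range N, |x| ^ n / (n.factorial : ℝ) := by
        refine Finset.sum_congr rfl fun n _ => ?_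
        rw [abs_div, abs_pow, Nat.abs_cast]
    _ ≤ Real.exp |x| := by
        have h : HasSum (fun n : ℕ => |x| ^ n / (n.factorial : ℝ)) (Real.exp |x|) := by
          rw [Real.exp_eq_exp_ℝ]
          exact NormedSpace.expSeries_div_hasSum_exp _
        exact sum_le_hasSum _ (fun n _ => by positivity) h

/-- The Taylor polynomials of `exp` are continuous. [folklore] -/
theorem continuous_expTaylor (N : ℕ) : Continuous (expTaylor N) := by
  unfold expTaylor
  fun_prop

/-- A bounded a.e., a.e.-strongly measurable real function on a finite measure space is integrable.
[folklore] -/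
theorem integrable_of_ae_abs_le {α : Type*} [MeasurableSpace α] {μ : Measure α} [IsFiniteMeasure μ]
    {f : α → ℝ} (hf : AEStronglyMeasurable f μ) (R : ℝ) (h : ∀ᵐ x ∂μ, |f x| ≤ R) :
    Integrable f μ :=
  (integrable_const R).mono' hf (h.mono fun x hx => by rw [Real.norm_eq_abs]; exact hx)

/-- `|∏ᵢ f i| ≤ R ^ n` when `|f i| ≤ R`. [folklore] -/
theorem abs_prod_le_pow {n : ℕ} (f : Fin n → ℝ) {R : ℝ} (h : ∀ i, |f i| ≤ R) :
    |∏ i, f i| ≤ R ^ n := by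
  rw [Finset.abs_prod]
  calc ∏ i, |f i| ≤ ∏ _i : Fin n, R := Finset.prod_le_prod (fun i _ => abs_nonneg _) fun i _ => h i
    _ = R ^ n := by rw [Finset.prod_const, Finset.card_univ, Fintype.card_fin]

variable (m : Measure T) (β : ℝ)

/-- The two-variable functional `∫∫ Φ(τ)Ψ(τ') exp{β ∑_c p_c(τ) q_c(τ')} dm(τ) dm(τ')`
(Friedli–Velenik 2017, Lemma 10.28, `⟨e^{A + Θ(B) + ∑_α C_α Θ(D_α)}⟩`). [cite: FriedliVelenik2017, Lemma 10.28] -/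
def kerInt (Φ Ψ : T → ℝ) (p q : C → T → ℝ) : ℝ :=
  ∫ z, Φ z.1 * Ψ z.2 * Real.exp (β * ∑ c, p c z.1 * q c z.2) ∂(m.prod m)

/-- The same functional with the exponential replaced by its Taylor polynomial of order `N`
(the partial sums of (10.44)). [cite: FriedliVelenik2017, Lemma 10.28, eq. (10.44)] -/
def kerIntN (N : ℕ) (Φ Ψ : T → ℝ) (p q : C → T → ℝ) : ℝ :=
  ∫ z, Φ z.1 * Ψ z.2 * expTaylor N (β * ∑ c, p c z.1 * q c z.2) ∂(m.prod m)

/-- The moments `∫ Φ ∏ₘ p_{w m} dm` of (10.44). [cite: FriedliVelenik2017, Lemma 10.28, eq. (10.44)] -/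
def kerMoment (Φ : T → ℝ) (p : C → T → ℝ) (n : ℕ) (w : Fin n → C) : ℝ :=
  ∫ τ, Φ τ * ∏ i, p (w i) τ ∂m

variable {m β}

omit [MeasurableSpace T] in
/-- Pointwise expansion of the truncated kernel:
`Φ(τ)Ψ(τ') ∑_{n<N} (β∑_c p_c q_c)ⁿ/n! = ∑_{n<N} βⁿ/n! ∑_w (Φ∏p_w)(τ) (Ψ∏q_w)(τ')`. [folklore] -/
theorem kernel_expTaylor_expand (N : ℕ) (Φ Ψ : T → ℝ) (p q : C → T → ℝ) (z : T × T) :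
    Φ z.1 * Ψ z.2 * expTaylor N (β * ∑ c, p c z.1 * q c z.2) =
      ∑ n ∈ Finset.range N, β ^ n / (n.factorial : ℝ) *
        ∑ w : Fin n → C, (Φ z.1 * ∏ i, p (w i) z.1) * (Ψ z.2 * ∏ i, q (w i) z.2) := by
  unfold expTaylor
  rw [Finset.mul_sum]
  refine Finset.sum_congr rfl fun n _ => ?_
  rw [mul_pow, sum_pow_eq_sum_fun, Finset.mul_sum, Finset.mul_sum, Finset.sum_div, Finset.mul_sum]
  refine Finset.sum_congr rfl fun w _ => ?_
  rw [Finset.prod_mul_distrib]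
  ring

variable [IsFiniteMeasure m]

omit [Fintype C] in
/-- The moments' integrands are integrable (bounded a.e.). [folklore] -/
theorem integrable_mul_prod_feature {Φ : T → ℝ} {p : C → T → ℝ} (hΦm : Measurable Φ)
    (hpm : ∀ c, Measurable (p c)) {R : ℝ} (hR : 0 ≤ R) (hΦb : ∀ᵐ τ ∂m, |Φ τ| ≤ R)
    (hpb : ∀ᵐ τ ∂m, ∀ c, |p c τ| ≤ R) {n : ℕ} (w : Fin n → C) :
    Integrable (fun τ => Φ τ * ∏ i, p (w i) τ) m := by
  refine integrable_of_ae_abs_le ?_ (R * R ^ n) ?_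
  · exact (hΦm.mul (Finset.measurable_prod _ fun i _ => hpm (w i))).aestronglyMeasurable
  · filter_upwards [hΦb, hpb] with τ h1 h2
    rw [abs_mul]
    exact mul_le_mul h1 (abs_prod_le_pow _ fun i => h2 (w i)) (abs_nonneg _) hR

/-- **(10.44), truncated**: `∫∫ ΦΨ T_N(β∑pq) = ∑_{n<N} βⁿ/n! ∑_w (∫Φ∏p_w)(∫Ψ∏q_w)`. [cite: FriedliVelenik2017, Lemma 10.28, eq. (10.44)] -/
theorem kerIntN_eq_sum {Φ Ψ : T → ℝ} {p q : C → T → ℝ} (hΦm : Measurable Φ) (hΨm : Measurable Ψ)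
    (hpm : ∀ c, Measurable (p c)) (hqm : ∀ c, Measurable (q c)) {R : ℝ} (hR : 0 ≤ R)
    (hΦb : ∀ᵐ τ ∂m, |Φ τ| ≤ R) (hΨb : ∀ᵐ τ ∂m, |Ψ τ| ≤ R)
    (hpb : ∀ᵐ τ ∂m, ∀ c, |p c τ| ≤ R) (hqb : ∀ᵐ τ ∂m, ∀ c, |q c τ| ≤ R) (N : ℕ) :
    kerIntN m β N Φ Ψ p q =
      ∑ n ∈ Finset.range N, β ^ n / (n.factorial : ℝ) *
        ∑ w : Fin n → C, kerMoment m Φ p n w * kerMoment m Ψ q n w := by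
  unfold kerIntN kerMoment
  simp_rw [kernel_expTaylor_expand]
  have hint : ∀ (n : ℕ) (w : Fin n → C), Integrable
      (fun z : T × T => (Φ z.1 * ∏ i, p (w i) z.1) * (Ψ z.2 * ∏ i, q (w i) z.2)) (m.prod m) :=
    fun n w => (integrable_mul_prod_feature hΦm hpm hR hΦb hpb w).mul_prod
      (integrable_mul_prod_feature hΨm hqm hR hΨb hqb w)
  rw [integral_finsetSum _ fun n _ => (Integrable.const_mul (integrable_finsetSum _
    fun w _ => hint n w) _)]
  refine Finset.sum_congr rfl fun n _ => ?_
  rw [integral_const_mul, integral_finsetSum _ fun w _ => hint n w]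
  congr 1
  refine Finset.sum_congr rfl fun w _ => ?_
  exact integral_prod_mul (fun τ => Φ τ * ∏ i, p (w i) τ) (fun τ => Ψ τ * ∏ i, q (w i) τ)

omit [IsFiniteMeasure m] in
/-- **Cauchy–Schwarz for the truncated series** (the two applications of the classical
Cauchy–Schwarz inequality in the proof of Friedli–Velenik 2017, Lemma 10.28, here through the
discriminant of `t ↦ ∑_n βⁿ/n! ∑_w (a_w - t b_w)² ≥ 0`). [cite: FriedliVelenik2017, Lemma 10.28] -/
theorem truncated_cauchySchwarz (hβ : 0 ≤ β) (N : ℕ) (a b : (n : ℕ) → (Fin n → C) → ℝ) :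
    (∑ n ∈ Finset.range N, β ^ n / (n.factorial : ℝ) * ∑ w : Fin n → C, a n w * b n w) ^ 2 ≤
      (∑ n ∈ Finset.range N, β ^ n / (n.factorial : ℝ) * ∑ w : Fin n → C, a n w * a n w) *
        (∑ n ∈ Finset.range N, β ^ n / (n.factorial : ℝ) * ∑ w : Fin n → C, b n w * b n w) := by
  set M := ∑ n ∈ Finset.range N, β ^ n / (n.factorial : ℝ) * ∑ w : Fin n → C, a n w * b n w
  set A := ∑ n ∈ Finset.range N, β ^ n / (n.factorial : ℝ) * ∑ w : Fin n → C, a n w * a n w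
  set B := ∑ n ∈ Finset.range N, β ^ n / (n.factorial : ℝ) * ∑ w : Fin n → C, b n w * b n w
  have hquad : ∀ t : ℝ, 0 ≤ B * (t * t) + (-2 * M) * t + A := by
    intro t
    have h : 0 ≤ ∑ n ∈ Finset.range N, β ^ n / (n.factorial : ℝ) *
        ∑ w : Fin n → C, (a n w - t * b n w) ^ 2 :=
      Finset.sum_nonneg fun n _ => mul_nonneg (by positivity)
        (Finset.sum_nonneg fun w _ => sq_nonneg _)
    have he : ∑ n ∈ Finset.range N, β ^ n / (n.factorial : ℝ) *
        ∑ w : Fin n → C, (a n w - t * b n w) ^ 2 = B * (t * t) + (-2 * M) * t + A := by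
      simp only [M, A, B, Finset.mul_sum, Finset.sum_mul, ← Finset.sum_add_distrib]
      refine Finset.sum_congr rfl fun n _ => Finset.sum_congr rfl fun w _ => ?_
      ring
    rwa [he] at h
  have hd := discrim_le_zero hquad
  rw [discrim] at hd
  nlinarith

omit [IsFiniteMeasure m] in
/-- A.e. bounds on the two factors of `m.prod m`. [folklore] -/
theorem ae_prod_of_ae {P Q : T → Prop} (hP : ∀ᵐ τ ∂m, P τ) (hQ : ∀ᵐ τ ∂m, Q τ) :
    ∀ᵐ z ∂(m.prod m), P z.1 ∧ Q z.2 :=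
  ((Measure.quasiMeasurePreserving_fst (μ := m) (ν := m)).ae hP).and
    ((Measure.quasiMeasurePreserving_snd (μ := m) (ν := m)).ae hQ)

omit [MeasurableSpace T] [IsFiniteMeasure m] in
/-- `|∑_c p_c(τ) q_c(τ')| ≤ |C| R²` under the bounds `|p_c|, |q_c| ≤ R`. [folklore] -/
theorem abs_sum_mul_le {p q : C → T → ℝ} {R : ℝ} (hR : 0 ≤ R) {τ τ' : T}
    (hp : ∀ c, |p c τ| ≤ R) (hq : ∀ c, |q c τ'| ≤ R) :
    |∑ c, p c τ * q c τ'| ≤ Fintype.card C * R ^ 2 := by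
  calc |∑ c, p c τ * q c τ'| ≤ ∑ c, |p c τ * q c τ'| := Finset.abs_sum_le_sum_abs _ _
    _ ≤ ∑ _c : C, R ^ 2 := Finset.sum_le_sum fun c _ => by
        rw [abs_mul, sq]
        exact mul_le_mul (hp c) (hq c) (abs_nonneg _) hR
    _ = Fintype.card C * R ^ 2 := by rw [Finset.sum_const, Finset.card_univ, nsmul_eq_mul]

/-- **Resumming the series** (Friedli–Velenik 2017, proof of Lemma 10.28, "resumming the series"):
the truncated functionals converge to the exponential one, by dominated convergence (everything
is bounded a.e.). [cite: FriedliVelenik2017, Lemma 10.28] -/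
theorem tendsto_kerIntN {Φ Ψ : T → ℝ} {p q : C → T → ℝ} (hΦm : Measurable Φ) (hΨm : Measurable Ψ)
    (hpm : ∀ c, Measurable (p c)) (hqm : ∀ c, Measurable (q c)) {R : ℝ} (hR : 0 ≤ R)
    (hΦb : ∀ᵐ τ ∂m, |Φ τ| ≤ R) (hΨb : ∀ᵐ τ ∂m, |Ψ τ| ≤ R)
    (hpb : ∀ᵐ τ ∂m, ∀ c, |p c τ| ≤ R) (hqb : ∀ᵐ τ ∂m, ∀ c, |q c τ| ≤ R) :
    Tendsto (fun N => kerIntN m β N Φ Ψ p q) atTop (𝓝 (kerInt m β Φ Ψ p q)) := by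
  unfold kerIntN kerInt
  have hS : Measurable fun z : T × T => ∑ c, p c z.1 * q c z.2 :=
    Finset.measurable_sum _ fun c _ => ((hpm c).comp measurable_fst).mul ((hqm c).comp measurable_snd)
  have hΦΨ : Measurable fun z : T × T => Φ z.1 * Ψ z.2 :=
    (hΦm.comp measurable_fst).mul (hΨm.comp measurable_snd)
  refine tendsto_integral_of_dominated_convergence
    (fun _ => R * R * Real.exp (|β| * (Fintype.card C * R ^ 2))) (fun N => ?_) (integrable_const _)
    (fun N => ?_) ?_
  · exact (hΦΨ.mul ((continuous_expTaylor N).measurable.comp (hS.const_mul β))).aestronglyMeasurable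
  · filter_upwards [ae_prod_of_ae (m := m) hΦb hqb, ae_prod_of_ae (m := m) hpb hΨb] with z h1 h2
    rw [Real.norm_eq_abs, abs_mul, abs_mul]
    refine mul_le_mul (mul_le_mul h1.1 h2.2 (abs_nonneg _) hR) ?_ (abs_nonneg _) (by positivity)
    refine (abs_expTaylor_le N _).trans (Real.exp_le_exp.2 ?_)
    rw [abs_mul]
    exact mul_le_mul_of_nonneg_left (abs_sum_mul_le hR h2.1 h1.2) (abs_nonneg _)
  · exact ae_of_all _ fun z => (tendsto_expTaylor _).const_mul _

/-- **Lemma 10.28 (Cauchy–Schwarz for exponential kernels), integral form**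
(Friedli–Velenik 2017, Lemma 10.28: `⟨e^{A+Θ(B)+∑C_αΘ(D_α)}⟩² ≤ ⟨e^{A+Θ(A)+∑C_αΘ(C_α)}⟩⟨e^{B+Θ(B)+∑D_αΘ(D_α)}⟩`
for a reflection-positive product measure; here for the product `m ⊗ m` of a finite measure with
itself, `e^A = Φ(τ)`, `Θ(e^B) = Ψ(τ')`, `C_c = √β p_c(τ)`, `Θ(D_c) = √β q_c(τ')`): for `β ≥ 0` and
bounded measurable data,
`(∫∫ Φ(τ)Ψ(τ') e^{β∑_c p_c(τ)q_c(τ')})² ≤ (∫∫ ΦΦ e^{β∑pp}) (∫∫ ΨΨ e^{β∑qq})`.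
Proof as printed: expand the exponential ((10.44)), Cauchy–Schwarz termwise and in the sum over
`n` (`truncated_cauchySchwarz`), and resum (`tendsto_kerIntN`). [cite: FriedliVelenik2017, Lemma 10.28] -/
theorem kerInt_sq_le (hβ : 0 ≤ β) {Φ Ψ : T → ℝ} {p q : C → T → ℝ} (hΦm : Measurable Φ)
    (hΨm : Measurable Ψ) (hpm : ∀ c, Measurable (p c)) (hqm : ∀ c, Measurable (q c)) {R : ℝ}
    (hR : 0 ≤ R) (hΦb : ∀ᵐ τ ∂m, |Φ τ| ≤ R) (hΨb : ∀ᵐ τ ∂m, |Ψ τ| ≤ R)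
    (hpb : ∀ᵐ τ ∂m, ∀ c, |p c τ| ≤ R) (hqb : ∀ᵐ τ ∂m, ∀ c, |q c τ| ≤ R) :
    kerInt m β Φ Ψ p q ^ 2 ≤ kerInt m β Φ Φ p p * kerInt m β Ψ Ψ q q := by
  have hM := tendsto_kerIntN (β := β) hΦm hΨm hpm hqm hR hΦb hΨb hpb hqb
  have hA := tendsto_kerIntN (β := β) hΦm hΦm hpm hpm hR hΦb hΦb hpb hpb
  have hB := tendsto_kerIntN (β := β) hΨm hΨm hqm hqm hR hΨb hΨb hqb hqb
  refine le_of_tendsto_of_tendsto' (hM.pow 2) (hA.mul hB) fun N => ?_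
  rw [kerIntN_eq_sum hΦm hΨm hpm hqm hR hΦb hΨb hpb hqb,
    kerIntN_eq_sum hΦm hΦm hpm hpm hR hΦb hΦb hpb hpb,
    kerIntN_eq_sum hΨm hΨm hqm hqm hR hΨb hΨb hqb hqb]
  exact truncated_cauchySchwarz hβ N (kerMoment m Φ p) (kerMoment m Ψ q)

end ExpKernelIntegral

/-! ### Compactly supported single-spin measures: a.e. bounds and integrability -/

section SpinMeasure

variable {ν : ℕ}

/-- A compact set of `ℝ^ν` is bounded coordinatewise. [folklore] -/
theorem exists_abs_apply_le_of_isCompact {K : Set (Fin ν → ℝ)} (hK : IsCompact K) :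
    ∃ R : ℝ, 0 ≤ R ∧ ∀ s ∈ K, ∀ a, |s a| ≤ R := by
  obtain ⟨r, hr⟩ := hK.isBounded.subset_closedBall 0
  refine ⟨max r 0, le_max_right _ _, fun s hs a => ?_⟩
  have h1 : ‖s‖ ≤ r := by simpa [dist_zero_right] using hr hs
  exact ((Real.norm_eq_abs _).symm.le.trans (norm_le_pi_norm s a)).trans (h1.trans (le_max_left _ _))

variable {ι : Type*} [Fintype ι] (ρ : Measure (Fin ν → ℝ))

/-- Under the product measure `⊗_ι ρ`, a `ρ`-a.e. property holds a.e. at every coordinate. [folklore] -/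
theorem ae_pi_forall {p : (Fin ν → ℝ) → Prop} [SigmaFinite ρ] (hp : ∀ᵐ s ∂ρ, p s) :
    ∀ᵐ τ ∂(Measure.pi fun _ : ι => ρ), ∀ i, p (τ i) := by
  have : ∀ i : ι, ∀ᵐ τ ∂(Measure.pi fun _ : ι => ρ), p (τ i) := fun i =>
    (Measure.tendsto_eval_ae_ae (μ := fun _ : ι => ρ) (i := i)).eventually hp
  exact ae_all_iff.2 this

/-- Under the product measure `⊗_ι ρ` with `ρ(Kᶜ) = 0`, a.e. every coordinate lies in `K`. [folklore] -/
theorem ae_pi_forall_mem [SigmaFinite ρ] {K : Set (Fin ν → ℝ)} (hK : ρ Kᶜ = 0) :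
    ∀ᵐ τ ∂(Measure.pi fun _ : ι => ρ), ∀ i, τ i ∈ K :=
  ae_pi_forall ρ (mem_ae_iff.2 hK)

/-- A continuous function of finitely many compactly supported spins is integrable against the
(finite) product measure. [folklore] -/
theorem integrable_pi_of_continuous [IsFiniteMeasure ρ] {K : Set (Fin ν → ℝ)} (hKc : IsCompact K)
    (hK : ρ Kᶜ = 0) {f : (ι → Fin ν → ℝ) → ℝ} (hf : Continuous f) :
    Integrable f (Measure.pi fun _ : ι => ρ) := by
  have hcpt : IsCompact (Set.pi Set.univ fun _ : ι => K) := isCompact_univ_pi fun _ => hKc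
  obtain ⟨C, hC⟩ := hcpt.exists_bound_of_continuousOn hf.continuousOn
  refine (integrable_const C).mono' hf.aestronglyMeasurable ?_
  filter_upwards [ae_pi_forall_mem (ι := ι) ρ hK] with τ hτ
  exact hC τ fun i _ => hτ i

/-- The product measure of a nonzero measure is nonzero. [folklore] -/
theorem pi_ne_zero [SigmaFinite ρ] (hρ : ρ ≠ 0) : (Measure.pi fun _ : ι => ρ) ≠ 0 := by
  intro h
  have h1 : (Measure.pi fun _ : ι => ρ) (Set.pi Set.univ fun _ => Set.univ) = 0 := by
    rw [h]; rfl
  rw [Measure.pi_pi] at h1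
  obtain ⟨i, -, hi⟩ := Finset.prod_eq_zero_iff.1 h1
  exact hρ (Measure.measure_univ_eq_zero.1 hi)

end SpinMeasure

/-! ### The bond form of vector fields and the functional `Z(h)` of Gaussian domination -/

section VectorForms

variable {V : Type*} [Fintype V] (G : SimpleGraph V) [DecidableRel G.Adj] {ν : ℕ}

/-- The bond form of `ν`-component fields, `𝓔(f,g) = ∑_{{x,y} ∈ E} (f_x - f_y)·(g_x - g_y)
= ∑_a 𝓔(f^a, g^a)` (Friedli–Velenik 2017, §10.5.3, the quadratic forms in (10.47)). [cite: FriedliVelenik2017, §10.5.3, eq. (10.47)] -/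
def vecGradForm (f g : V → Fin ν → ℝ) : ℝ :=
  ∑ a, gradForm G (fun x => f x a) (fun x => g x a)

variable {G}

omit [Fintype V] in
/-- Pushing a finite sum through `Sym2.lift`. [folklore] -/
theorem sum_sym2_lift {α : Type*} (s : Finset α) (F : α → V → V → ℝ)
    (hF : ∀ a x y, F a x y = F a y x) (e : Sym2 V) :
    ∑ a ∈ s, Sym2.lift ⟨F a, hF a⟩ e =
      Sym2.lift ⟨fun x y => ∑ a ∈ s, F a x y, fun x y => Finset.sum_congr rfl fun a _ => hF a x y⟩ e := by
  induction e using Sym2.ind with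
  | _ x y => simp

/-- The vector bond form as a single edge sum. [folklore] -/
theorem vecGradForm_eq_sum (f g : V → Fin ν → ℝ) :
    vecGradForm G f g = ∑ e ∈ G.edgeFinset,
      Sym2.lift ⟨fun x y => ∑ a, (f x a - f y a) * (g x a - g y a), fun x y =>
        Finset.sum_congr rfl fun a _ => by ring⟩ e := by
  unfold vecGradForm gradForm
  rw [Finset.sum_comm]
  refine Finset.sum_congr rfl fun e _ => ?_
  exact sum_sym2_lift Finset.univ (fun a x y => (f x a - f y a) * (g x a - g y a)) (fun a x y => by ring) e

/-- Expansion of the vector quadratic form along a line: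
`𝓔(s + t h) = 𝓔(s) + 2t 𝓔(s,h) + t² 𝓔(h)`. [folklore] -/
theorem vecGradForm_add_smul_self (s h : V → Fin ν → ℝ) (t : ℝ) :
    vecGradForm G (s + t • h) (s + t • h) =
      vecGradForm G s s + 2 * t * vecGradForm G s h + t ^ 2 * vecGradForm G h h := by
  unfold vecGradForm
  rw [Finset.mul_sum, Finset.mul_sum, ← Finset.sum_add_distrib, ← Finset.sum_add_distrib]
  refine Finset.sum_congr rfl fun a _ => ?_
  have := gradForm_add_smul_self (G := G) (fun x => s x a) (fun x => h x a) t
  convert this using 2 <;> rfl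

/-- The vector quadratic form is nonnegative. [folklore] -/
theorem vecGradForm_self_nonneg (f : V → Fin ν → ℝ) : 0 ≤ vecGradForm G f f :=
  Finset.sum_nonneg fun _ _ => gradForm_self_nonneg _

/-- The vector bond form is continuous in its first argument. [folklore] -/
theorem continuous_vecGradForm_left (g : V → Fin ν → ℝ) :
    Continuous fun f : V → Fin ν → ℝ => vecGradForm G f g := by
  unfold vecGradForm gradForm
  refine continuous_finsetSum _ fun a _ => continuous_finsetSum _ fun e _ => ?_
  induction e using Sym2.ind with
  | _ x y => simp only [gradForm_term_mk]; fun_prop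

/-- The vector quadratic form is continuous. [folklore] -/
theorem continuous_vecGradForm_self :
    Continuous fun f : V → Fin ν → ℝ => vecGradForm G f f := by
  unfold vecGradForm gradForm
  refine continuous_finsetSum _ fun a _ => continuous_finsetSum _ fun e _ => ?_
  induction e using Sym2.ind with
  | _ x y => simp only [gradForm_term_mk]; fun_prop

variable (G) (ρ : Measure (Fin ν → ℝ)) (β : ℝ)

/-- **The functional `Z_{G;β}(h)` of Gaussian domination** (Friedli–Velenik 2017, §10.5.3, display
before Prop. 10.27): `Z(h) = ∫ exp{-β ∑_{{x,y} ∈ E} ‖ω_x - ω_y + h_x - h_y‖₂²} dμ₀(ω)`,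
`μ₀ = ⊗_{x ∈ V} ρ`. [cite: FriedliVelenik2017, §10.5.3, display before Prop. 10.27] -/
def vZ (h : V → Fin ν → ℝ) : ℝ :=
  ∫ ω, Real.exp (-β * vecGradForm G (ω + h) (ω + h)) ∂(Measure.pi fun _ : V => ρ)

variable {G ρ β}

/-- The integrand of `Z(h)` is continuous. [folklore] -/
theorem continuous_vZ_integrand (β : ℝ) (h : V → Fin ν → ℝ) :
    Continuous fun ω : V → Fin ν → ℝ => Real.exp (-β * vecGradForm G (ω + h) (ω + h)) :=
  ((continuous_vecGradForm_self (G := G)).comp (continuous_id.add continuous_const)).const_mul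
    (-β) |>.rexp

/-- The integrand of `Z(h)` is at most `1` for `β ≥ 0`. [folklore] -/
theorem vZ_integrand_le_one {β : ℝ} (hβ : 0 ≤ β) (h ω : V → Fin ν → ℝ) :
    Real.exp (-β * vecGradForm G (ω + h) (ω + h)) ≤ 1 := by
  rw [Real.exp_le_one_iff, neg_mul, neg_nonpos]
  exact mul_nonneg hβ (vecGradForm_self_nonneg _)

/-- The integrand of `Z(h)` is integrable (`β ≥ 0`, `ρ` finite). [folklore] -/
theorem integrable_vZ_integrand [IsFiniteMeasure ρ] {β : ℝ} (hβ : 0 ≤ β) (h : V → Fin ν → ℝ) :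
    Integrable (fun ω : V → Fin ν → ℝ => Real.exp (-β * vecGradForm G (ω + h) (ω + h)))
      (Measure.pi fun _ : V => ρ) := by
  refine (integrable_const (1 : ℝ)).mono' (continuous_vZ_integrand β h).aestronglyMeasurable
    (ae_of_all _ fun ω => ?_)
  rw [Real.norm_eq_abs, abs_of_pos (Real.exp_pos _)]
  exact vZ_integrand_le_one hβ h ω

/-- `Z(h) > 0` (`β ≥ 0`, `ρ` finite and nonzero). [folklore] -/
theorem vZ_pos [IsFiniteMeasure ρ] (hρ : ρ ≠ 0) {β : ℝ} (hβ : 0 ≤ β) (h : V → Fin ν → ℝ) :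
    0 < vZ G ρ β h := by
  haveI : NeZero (Measure.pi fun _ : V => ρ) := ⟨pi_ne_zero ρ hρ⟩
  exact integral_exp_pos (integrable_vZ_integrand hβ h)

end VectorForms

/-! ### Reflections: the half exponent, the two-half kernel and the splitting of `Z(h)` -/

section Reflection

variable {V : Type*} [Fintype V] [DecidableEq V] (G : SimpleGraph V) [DecidableRel G.Adj]
  (θ : V ≃ V) (P : Finset V) {ν : ℕ}

/-- The half exponent `A` of Friedli–Velenik 2017, proof of Prop. 10.27:
`-β[∑_{{x,y} ⊆ 𝕋₊} ‖ω_x - ω_y + g_x - g_y‖² + ∑_{x crossing} ‖ω_x + g_x‖²]`. [cite: FriedliVelenik2017, §10.5.3, proof of Prop. 10.27] -/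
def halfExp (β : ℝ) (g ω : V → Fin ν → ℝ) : ℝ :=
  -β * (∑ e ∈ innerEdges G P,
      Sym2.lift ⟨fun x y => ∑ a, (ω x a + g x a - (ω y a + g y a)) ^ 2, fun x y =>
        Finset.sum_congr rfl fun a _ => by ring⟩ e +
    ∑ x ∈ crossSites G θ P, ∑ a, (ω x a + g x a) ^ 2)

/-- Extension by `0` of a half configuration `τ ∈ (ℝ^ν)^{𝕋₊}` to the whole vertex set. [folklore] -/
def extCfg (P : Finset V) (τ : ↥P → Fin ν → ℝ) : V → Fin ν → ℝ :=
  fun x => if hx : x ∈ P then τ ⟨x, hx⟩ else 0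

/-- The two-half kernel `e^{A_{g₁}(τ)} e^{A_{g₂}(τ')} e^{2β ∑_{x crossing} (τ_x + g₁(x))·(τ'_x + g₂(x))}`
of Friedli–Velenik 2017, Lemma 10.28 / proof of Prop. 10.27 (`C_x = √(2β)(ω_x + h_x)`,
`Θ(D_x) = √(2β)(ω_{θx} + h_{θx})`). [cite: FriedliVelenik2017, Lemma 10.28 and proof of Prop. 10.27] -/
def pairKernel (β : ℝ) (g₁ g₂ : V → Fin ν → ℝ)
    (z : (↥P → Fin ν → ℝ) × (↥P → Fin ν → ℝ)) : ℝ :=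
  Real.exp (halfExp G θ P β g₁ (extCfg P z.1)) * Real.exp (halfExp G θ P β g₂ (extCfg P z.2)) *
    Real.exp (2 * β * ∑ x ∈ crossSites G θ P, ∑ a,
      (extCfg P z.1 x a + g₁ x a) * (extCfg P z.2 x a + g₂ x a))

/-- The two-half functional `⟨e^{A + Θ(B) + ∑ C Θ(D)}⟩` as an integral over pairs of half
configurations against `(⊗_{𝕋₊} ρ) ⊗ (⊗_{𝕋₊} ρ)`. [cite: FriedliVelenik2017, Lemma 10.28 and proof of Prop. 10.27] -/
def pairInt (ρ : Measure (Fin ν → ℝ)) (β : ℝ) (g₁ g₂ : V → Fin ν → ℝ) : ℝ :=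
  ∫ z, pairKernel G θ P β g₁ g₂ z
    ∂((Measure.pi fun _ : ↥P => ρ).prod (Measure.pi fun _ : ↥P => ρ))

/-- The symmetrised field `h⁺` (`h` on `𝕋₊`, `h ∘ θ` off `𝕋₊`). [cite: FriedliVelenik2017, §10.5.3, proof of Prop. 10.27] -/
def reflPlus (h : V → Fin ν → ℝ) : V → Fin ν → ℝ := fun x => if x ∈ P then h x else h (θ x)

/-- The symmetrised field `h⁻` (`h ∘ θ` on `𝕋₊`, `h` off `𝕋₊`). [cite: FriedliVelenik2017, §10.5.3, proof of Prop. 10.27] -/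
def reflMinus (h : V → Fin ν → ℝ) : V → Fin ν → ℝ := fun x => if x ∈ P then h (θ x) else h x

variable {G θ P}

omit [Fintype V] in
/-- `extCfg` on `𝕋₊`. [folklore] -/
@[simp] theorem extCfg_apply_of_mem (τ : ↥P → Fin ν → ℝ) {x : V} (hx : x ∈ P) :
    extCfg P τ x = τ ⟨x, hx⟩ := by
  simp [extCfg, hx]

omit [Fintype V] in
/-- `extCfg` is continuous. [folklore] -/
theorem continuous_extCfg : Continuous (extCfg (ν := ν) P) := by
  refine continuous_pi fun x => ?_
  by_cases hx : x ∈ P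
  · simp only [extCfg, hx, dite_true]; fun_prop
  · simp only [extCfg, hx, dite_false]; fun_prop

/-- The half exponent depends on the field and the configuration only through their values on
`𝕋₊`. [folklore] -/
theorem halfExp_congr (β : ℝ) {g g' ω ω' : V → Fin ν → ℝ} (hg : ∀ x ∈ P, g x = g' x)
    (hω : ∀ x ∈ P, ω x = ω' x) :
    halfExp G θ P β g ω = halfExp G θ P β g' ω' := by
  unfold halfExp
  congr 2
  · refine Finset.sum_congr rfl fun e he => ?_
    have hmem := fun z => mem_of_mem_innerEdges (G := G) (P := P) he (z := z)
    revert hmem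
    induction e using Sym2.ind with
    | _ x y =>
      intro hmem
      simp only [Sym2.lift_mk]
      rw [hg x (hmem x (Sym2.mem_mk_left x y)), hg y (hmem y (Sym2.mem_mk_right x y)),
        hω x (hmem x (Sym2.mem_mk_left x y)), hω y (hmem y (Sym2.mem_mk_right x y))]
  · exact Finset.sum_congr rfl fun x hx => by
      rw [hg x (mem_of_mem_crossSites hx), hω x (mem_of_mem_crossSites hx)]

/-- The half exponent is nonpositive for `β ≥ 0`. [folklore] -/
theorem halfExp_nonpos {β : ℝ} (hβ : 0 ≤ β) (g ω : V → Fin ν → ℝ) : halfExp G θ P β g ω ≤ 0 := by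
  unfold halfExp
  rw [neg_mul, neg_nonpos]
  refine mul_nonneg hβ (add_nonneg (Finset.sum_nonneg fun e _ => ?_)
    (Finset.sum_nonneg fun x _ => Finset.sum_nonneg fun a _ => sq_nonneg _))
  induction e using Sym2.ind with
  | _ x y =>
    simp only [Sym2.lift_mk]
    exact Finset.sum_nonneg fun a _ => sq_nonneg _

/-- The half exponent is continuous in the configuration. [folklore] -/
theorem continuous_halfExp (β : ℝ) (g : V → Fin ν → ℝ) :
    Continuous fun ω : V → Fin ν → ℝ => halfExp G θ P β g ω := by
  unfold halfExp
  refine (Continuous.add (continuous_finsetSum _ fun e _ => ?_) (by fun_prop)).const_mul _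
  induction e using Sym2.ind with
  | _ x y => simp only [Sym2.lift_mk]; fun_prop

/-- `pairInt` depends on the fields only through their values on `𝕋₊`. [folklore] -/
theorem pairInt_congr (ρ : Measure (Fin ν → ℝ)) (β : ℝ) {g₁ g₁' g₂ g₂' : V → Fin ν → ℝ}
    (h₁ : ∀ x ∈ P, g₁ x = g₁' x) (h₂ : ∀ x ∈ P, g₂ x = g₂' x) :
    pairInt G θ P ρ β g₁ g₂ = pairInt G θ P ρ β g₁' g₂' := by
  unfold pairInt pairKernel
  refine integral_congr_ae (ae_of_all _ fun z => ?_)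
  simp only
  rw [halfExp_congr β h₁ fun _ _ => rfl, halfExp_congr β h₂ fun _ _ => rfl,
    Finset.sum_congr rfl fun x hx => by
      rw [h₁ x (mem_of_mem_crossSites hx), h₂ x (mem_of_mem_crossSites hx)]]

/-- **The exponent of `Z(h)` split along a reflection** (Friedli–Velenik 2017, proof of
Prop. 10.27: `-β∑‖ω_i - ω_j + h_i - h_j‖² = A + Θ(B) + ∑_{i'} C_{i'}·Θ(D_{i'})`, using
`‖ω_{i'} - ω_{j'} + h_{i'} - h_{j'}‖² = ‖ω_{i'} + h_{i'}‖² + ‖ω_{j'} + h_{j'}‖² - 2(ω_{i'} + h_{i'})·(ω_{j'} + h_{j'})`).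
[cite: FriedliVelenik2017, §10.5.3, proof of Prop. 10.27] -/
theorem exponent_split (hθ : ∀ x, θ (θ x) = x) (hadj : ∀ x y, G.Adj (θ x) (θ y) ↔ G.Adj x y)
    (hP : ∀ x, x ∈ P ↔ θ x ∉ P) (hcross : ∀ x y, x ∈ P → y ∉ P → G.Adj x y → y = θ x)
    (β : ℝ) (g ω : V → Fin ν → ℝ) :
    -β * vecGradForm G (ω + g) (ω + g) =
      halfExp G θ P β g ω + halfExp G θ P β (g ∘ θ) (ω ∘ θ) +
        2 * β * ∑ x ∈ crossSites G θ P, ∑ a, (ω x a + g x a) * ((ω ∘ θ) x a + (g ∘ θ) x a) := by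
  rw [vecGradForm_eq_sum, sum_edgeFinset_reflect_split hθ hadj hP hcross]
  unfold halfExp
  have hin : ∑ e ∈ innerEdges G P, Sym2.lift ⟨fun x y => ∑ a,
      ((ω + g) x a - (ω + g) y a) * ((ω + g) x a - (ω + g) y a), fun x y =>
        Finset.sum_congr rfl fun a _ => by ring⟩ e =
      ∑ e ∈ innerEdges G P, Sym2.lift ⟨fun x y => ∑ a, (ω x a + g x a - (ω y a + g y a)) ^ 2,
        fun x y => Finset.sum_congr rfl fun a _ => by ring⟩ e := by
    refine Finset.sum_congr rfl fun e _ => ?_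
    induction e using Sym2.ind with
    | _ x y =>
      simp only [Sym2.lift_mk, Pi.add_apply]
      exact Finset.sum_congr rfl fun a _ => by ring
  have hout : ∑ e ∈ innerEdges G P, Sym2.lift ⟨fun x y => ∑ a,
      ((ω + g) x a - (ω + g) y a) * ((ω + g) x a - (ω + g) y a), fun x y =>
        Finset.sum_congr rfl fun a _ => by ring⟩ (Sym2.map θ e) =
      ∑ e ∈ innerEdges G P, Sym2.lift ⟨fun x y => ∑ a,
        ((ω ∘ θ) x a + (g ∘ θ) x a - ((ω ∘ θ) y a + (g ∘ θ) y a)) ^ 2,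
          fun x y => Finset.sum_congr rfl fun a _ => by ring⟩ e := by
    refine Finset.sum_congr rfl fun e _ => ?_
    induction e using Sym2.ind with
    | _ x y =>
      rw [Sym2.map_mk]
      simp only [Sym2.lift_mk, Pi.add_apply, Function.comp_apply]
      exact Finset.sum_congr rfl fun a _ => by ring
  have hcr : ∑ x ∈ crossSites G θ P, Sym2.lift ⟨fun x y => ∑ a,
      ((ω + g) x a - (ω + g) y a) * ((ω + g) x a - (ω + g) y a), fun x y =>
        Finset.sum_congr rfl fun a _ => by ring⟩ s(x, θ x) =
      ∑ x ∈ crossSites G θ P, ∑ a, (ω x a + g x a) ^ 2 +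
        ∑ x ∈ crossSites G θ P, ∑ a, ((ω ∘ θ) x a + (g ∘ θ) x a) ^ 2 -
          2 * ∑ x ∈ crossSites G θ P, ∑ a, (ω x a + g x a) * ((ω ∘ θ) x a + (g ∘ θ) x a) := by
    rw [Finset.mul_sum, ← Finset.sum_add_distrib, ← Finset.sum_sub_distrib]
    refine Finset.sum_congr rfl fun x _ => ?_
    simp only [Sym2.lift_mk, Pi.add_apply, Function.comp_apply]
    rw [Finset.mul_sum, ← Finset.sum_add_distrib, ← Finset.sum_sub_distrib]
    exact Finset.sum_congr rfl fun a _ => by ring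
  rw [hin, hout, hcr]
  ring

/-- The integrand of `Z(h)` is the two-half kernel evaluated at the split configuration
`(ω|_{𝕋₊}, (ω ∘ θ)|_{𝕋₊})`. [cite: FriedliVelenik2017, §10.5.3, proof of Prop. 10.27] -/
theorem exp_neg_mul_vecGradForm_eq_pairKernel (hθ : ∀ x, θ (θ x) = x)
    (hadj : ∀ x y, G.Adj (θ x) (θ y) ↔ G.Adj x y) (hP : ∀ x, x ∈ P ↔ θ x ∉ P)
    (hcross : ∀ x y, x ∈ P → y ∉ P → G.Adj x y → y = θ x) (β : ℝ) (g ω : V → Fin ν → ℝ) :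
    Real.exp (-β * vecGradForm G (ω + g) (ω + g)) =
      pairKernel G θ P β g (g ∘ θ) (fun x => ω x, fun x => ω (θ x)) := by
  rw [exponent_split hθ hadj hP hcross, Real.exp_add, Real.exp_add, pairKernel]
  have h1 : ∀ x ∈ P, ω x = extCfg P (fun x : ↥P => ω x) x := fun x hx => by
    rw [extCfg_apply_of_mem _ hx]
  have h2 : ∀ x ∈ P, (ω ∘ θ) x = extCfg P (fun x : ↥P => ω (θ x)) x := fun x hx => by
    rw [extCfg_apply_of_mem _ hx, Function.comp_apply]
  rw [halfExp_congr β (fun _ _ => rfl) h1, halfExp_congr β (fun _ _ => rfl) h2]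
  congr 3
  refine Finset.sum_congr rfl fun x hx => Finset.sum_congr rfl fun a _ => ?_
  rw [h1 x (mem_of_mem_crossSites hx), h2 x (mem_of_mem_crossSites hx)]

/-- The bijection `𝕋₊ ≃ 𝕋₋` induced by the reflection. [folklore] -/
def halfIndexEquiv (hθ : ∀ x, θ (θ x) = x) (hP : ∀ x, x ∈ P ↔ θ x ∉ P) :
    ↥P ≃ {x // x ∉ P} where
  toFun x := ⟨θ x, (hP x).1 x.2⟩
  invFun y := ⟨θ y, mem_of_not_mem_reflect hθ hP y.2⟩
  left_inv x := Subtype.ext (hθ x)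
  right_inv y := Subtype.ext (hθ y)

/-- **The splitting of a configuration along a reflection**, `ω ↦ (ω|_{𝕋₊}, (ω ∘ θ)|_{𝕋₊})`, as a
measurable equivalence `(ℝ^ν)^V ≃ (ℝ^ν)^{𝕋₊} × (ℝ^ν)^{𝕋₊}`. [folklore] -/
def splitEquiv (hθ : ∀ x, θ (θ x) = x) (hP : ∀ x, x ∈ P ↔ θ x ∉ P) :
    (V → Fin ν → ℝ) ≃ᵐ (↥P → Fin ν → ℝ) × (↥P → Fin ν → ℝ) :=
  (MeasurableEquiv.piEquivPiSubtypeProd (fun _ : V => Fin ν → ℝ) (· ∈ P)).trans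
    (MeasurableEquiv.prodCongr (MeasurableEquiv.refl (↥P → Fin ν → ℝ))
      (MeasurableEquiv.piCongrLeft (fun _ : {x // x ∉ P} => Fin ν → ℝ)
        (halfIndexEquiv hθ hP)).symm)

omit [Fintype V] in
/-- The splitting map, pointwise. [folklore] -/
theorem splitEquiv_apply (hθ : ∀ x, θ (θ x) = x) (hP : ∀ x, x ∈ P ↔ θ x ∉ P)
    (ω : V → Fin ν → ℝ) :
    splitEquiv (ν := ν) hθ hP ω = (fun x : ↥P => ω x, fun x : ↥P => ω (θ x)) := rfl

/-- **The splitting preserves the product measure**: `⊗_V ρ ↦ (⊗_{𝕋₊} ρ) ⊗ (⊗_{𝕋₊} ρ)`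
(independence of the spins in the two half-spaces under `μ₀`, the content of the reflection
positivity of `μ₀`, Friedli–Velenik 2017, Lemma 10.7). [cite: FriedliVelenik2017, Lemma 10.7] -/
theorem measurePreserving_splitEquiv (hθ : ∀ x, θ (θ x) = x) (hP : ∀ x, x ∈ P ↔ θ x ∉ P)
    (ρ : Measure (Fin ν → ℝ)) [SigmaFinite ρ] :
    MeasurePreserving (splitEquiv (ν := ν) hθ hP) (Measure.pi fun _ : V => ρ)
      ((Measure.pi fun _ : ↥P => ρ).prod (Measure.pi fun _ : ↥P => ρ)) := by
  -- the `Fintype ↥P` instance inside `measurePreserving_piEquivPiSubtypeProd` is `Subtype.fintype`,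
  -- not the canonical `Finset.Subtype.fintype`; `convert` identifies the two product measures
  have h1 : MeasurePreserving
      (MeasurableEquiv.piEquivPiSubtypeProd (fun _ : V => Fin ν → ℝ) (· ∈ P))
      (Measure.pi fun _ : V => ρ)
      ((Measure.pi fun _ : ↥P => ρ).prod (Measure.pi fun _ : {x // x ∉ P} => ρ)) := by
    convert measurePreserving_piEquivPiSubtypeProd (fun _ : V => ρ) (· ∈ P)
  have h2 : MeasurePreserving
      (MeasurableEquiv.piCongrLeft (fun _ : {x // x ∉ P} => Fin ν → ℝ) (halfIndexEquiv hθ hP)).symm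
      (Measure.pi fun _ : {x // x ∉ P} => ρ) (Measure.pi fun _ : ↥P => ρ) :=
    (measurePreserving_piCongrLeft (fun _ : {x // x ∉ P} => ρ) (halfIndexEquiv hθ hP)).symm _
  have h3 := (MeasurePreserving.id (Measure.pi fun _ : ↥P => ρ)).prod h2
  exact h3.comp h1

/-- **`Z(h) = ⟨e^{A + Θ(B) + ∑ C·Θ(D)}⟩` in two-half form**: `Z(h) = pairInt(h, h ∘ θ)`
(Friedli–Velenik 2017, proof of Prop. 10.27). [cite: FriedliVelenik2017, §10.5.3, proof of Prop. 10.27] -/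
theorem vZ_eq_pairInt (hθ : ∀ x, θ (θ x) = x) (hadj : ∀ x y, G.Adj (θ x) (θ y) ↔ G.Adj x y)
    (hP : ∀ x, x ∈ P ↔ θ x ∉ P) (hcross : ∀ x y, x ∈ P → y ∉ P → G.Adj x y → y = θ x)
    (ρ : Measure (Fin ν → ℝ)) [SigmaFinite ρ] (β : ℝ) (g : V → Fin ν → ℝ) :
    vZ G ρ β g = pairInt G θ P ρ β g (g ∘ θ) := by
  unfold vZ pairInt
  rw [← (measurePreserving_splitEquiv hθ hP ρ).integral_comp']
  refine integral_congr_ae (ae_of_all _ fun ω => ?_)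
  simp only
  rw [exp_neg_mul_vecGradForm_eq_pairKernel hθ hadj hP hcross, splitEquiv_apply]

omit [DecidableEq V] in
/-- A crude uniform bound on finitely many field values. [folklore] -/
theorem abs_apply_le_sum_abs (g : V → Fin ν → ℝ) (x : V) (a : Fin ν) :
    |g x a| ≤ ∑ y, ∑ b, |g y b| := by
  calc |g x a| ≤ ∑ b, |g x b| :=
        Finset.single_le_sum (f := fun b => |g x b|) (fun b _ => abs_nonneg _) (Finset.mem_univ a)
    _ ≤ ∑ y, ∑ b, |g y b| :=
        Finset.single_le_sum (f := fun y => ∑ b, |g y b|)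
          (fun y _ => Finset.sum_nonneg fun b _ => abs_nonneg _) (Finset.mem_univ x)

/-- **Lemma 10.28 for the two-half functional**: `pairInt(g₁,g₂)² ≤ pairInt(g₁,g₁) pairInt(g₂,g₂)`
for `β ≥ 0` and a finite, compactly supported single-spin measure (`kerInt_sq_le` with the
features `(τ, (x,a)) ↦ τ_x^a + g_x^a`, `x` crossing). [cite: FriedliVelenik2017, Lemma 10.28] -/
theorem pairInt_sq_le (ρ : Measure (Fin ν → ℝ)) [IsFiniteMeasure ρ] {K : Set (Fin ν → ℝ)}
    (hKc : IsCompact K) (hK : ρ Kᶜ = 0) {β : ℝ} (hβ : 0 ≤ β) (g₁ g₂ : V → Fin ν → ℝ) :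
    pairInt G θ P ρ β g₁ g₂ ^ 2 ≤ pairInt G θ P ρ β g₁ g₁ * pairInt G θ P ρ β g₂ g₂ := by
  set m : Measure (↥P → Fin ν → ℝ) := Measure.pi fun _ : ↥P => ρ with hm
  set Φ : (↥P → Fin ν → ℝ) → ℝ := fun τ => Real.exp (halfExp G θ P β g₁ (extCfg P τ)) with hΦ
  set Ψ : (↥P → Fin ν → ℝ) → ℝ := fun τ => Real.exp (halfExp G θ P β g₂ (extCfg P τ)) with hΨ
  set p : ↥(crossSites G θ P) × Fin ν → (↥P → Fin ν → ℝ) → ℝ :=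
    fun c τ => extCfg P τ c.1 c.2 + g₁ c.1 c.2 with hp
  set q : ↥(crossSites G θ P) × Fin ν → (↥P → Fin ν → ℝ) → ℝ :=
    fun c τ => extCfg P τ c.1 c.2 + g₂ c.1 c.2 with hq
  -- the three functionals are `kerInt`s
  have hker : ∀ (F₁ F₂ : (↥P → Fin ν → ℝ) → ℝ) (f₁ f₂ : V → Fin ν → ℝ),
      kerInt m (2 * β) F₁ F₂
        (fun (c : ↥(crossSites G θ P) × Fin ν) τ => extCfg P τ c.1 c.2 + f₁ c.1 c.2)
        (fun (c : ↥(crossSites G θ P) × Fin ν) τ => extCfg P τ c.1 c.2 + f₂ c.1 c.2) =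
      ∫ z, F₁ z.1 * F₂ z.2 * Real.exp (2 * β * ∑ x ∈ crossSites G θ P, ∑ a,
        (extCfg P z.1 x a + f₁ x a) * (extCfg P z.2 x a + f₂ x a)) ∂(m.prod m) := by
    intro F₁ F₂ f₁ f₂
    unfold kerInt
    refine integral_congr_ae (ae_of_all _ fun z => ?_)
    simp only
    rw [Fintype.sum_prod_type, Finset.sum_coe_sort (crossSites G θ P)
      (fun x => ∑ a, (extCfg P z.1 x a + f₁ x a) * (extCfg P z.2 x a + f₂ x a))]
  have e12 : pairInt G θ P ρ β g₁ g₂ = kerInt m (2 * β) Φ Ψ p q := by rw [hker]; rfl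
  have e11 : pairInt G θ P ρ β g₁ g₁ = kerInt m (2 * β) Φ Φ p p := by rw [hker]; rfl
  have e22 : pairInt G θ P ρ β g₂ g₂ = kerInt m (2 * β) Ψ Ψ q q := by rw [hker]; rfl
  rw [e12, e11, e22]
  -- bounds
  obtain ⟨RK, hRK0, hRK⟩ := exists_abs_apply_le_of_isCompact hKc
  set Rg : ℝ := ∑ y, ∑ b, |g₁ y b| + ∑ y, ∑ b, |g₂ y b| with hRg
  have hRg0 : 0 ≤ Rg := add_nonneg (Finset.sum_nonneg fun _ _ => Finset.sum_nonneg fun _ _ =>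
    abs_nonneg _) (Finset.sum_nonneg fun _ _ => Finset.sum_nonneg fun _ _ => abs_nonneg _)
  set R : ℝ := max 1 (RK + Rg) with hR
  have hR0 : 0 ≤ R := le_trans zero_le_one (le_max_left _ _)
  have hΦb : ∀ (f : V → Fin ν → ℝ), ∀ᵐ τ ∂m, |Real.exp (halfExp G θ P β f (extCfg P τ))| ≤ R := by
    intro f
    refine ae_of_all _ fun τ => ?_
    rw [abs_of_pos (Real.exp_pos _)]
    exact (Real.exp_le_one_iff.2 (halfExp_nonpos hβ _ _)).trans (le_max_left _ _)
  have hmem := ae_pi_forall_mem (ι := ↥P) ρ hK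
  have hpb : ∀ (f : V → Fin ν → ℝ), (∀ y b, |f y b| ≤ Rg) →
      ∀ᵐ τ ∂m, ∀ c : ↥(crossSites G θ P) × Fin ν, |extCfg P τ c.1 c.2 + f c.1 c.2| ≤ R := by
    intro f hf
    filter_upwards [hmem] with τ hτ c
    have hx : (c.1 : V) ∈ P := mem_of_mem_crossSites c.1.2
    rw [extCfg_apply_of_mem _ hx]
    calc |τ ⟨c.1, hx⟩ c.2 + f c.1 c.2| ≤ |τ ⟨c.1, hx⟩ c.2| + |f c.1 c.2| := abs_add_le _ _
      _ ≤ RK + Rg := add_le_add (hRK _ (hτ _) _) (hf _ _)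
      _ ≤ R := le_max_right _ _
  have hg₁ : ∀ y b, |g₁ y b| ≤ Rg := fun y b =>
    (abs_apply_le_sum_abs g₁ y b).trans (le_add_of_nonneg_right
      (Finset.sum_nonneg fun _ _ => Finset.sum_nonneg fun _ _ => abs_nonneg _))
  have hg₂ : ∀ y b, |g₂ y b| ≤ Rg := fun y b =>
    (abs_apply_le_sum_abs g₂ y b).trans (le_add_of_nonneg_left
      (Finset.sum_nonneg fun _ _ => Finset.sum_nonneg fun _ _ => abs_nonneg _))
  -- measurability
  have hΦm : ∀ f : V → Fin ν → ℝ, Measurable fun τ : ↥P → Fin ν → ℝ =>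
      Real.exp (halfExp G θ P β f (extCfg P τ)) := fun f =>
    (Real.continuous_exp.comp ((continuous_halfExp β f).comp continuous_extCfg)).measurable
  have hpm : ∀ (f : V → Fin ν → ℝ) (c : ↥(crossSites G θ P) × Fin ν),
      Measurable fun τ : ↥P → Fin ν → ℝ => extCfg P τ c.1 c.2 + f c.1 c.2 := fun f c =>
    (((continuous_apply c.2).comp ((continuous_apply (c.1 : V)).comp
      continuous_extCfg)).add continuous_const).measurable
  exact kerInt_sq_le (mul_nonneg zero_le_two hβ) (hΦm g₁) (hΦm g₂) (hpm g₁) (hpm g₂) hR0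
    (hΦb g₁) (hΦb g₂) (hpb g₁ hg₁) (hpb g₂ hg₂)

/-- **`Z(h)² ≤ Z(h⁺) Z(h⁻)`** (Friedli–Velenik 2017, proof of Prop. 10.27: "One can thus use
Lemma 10.28 to obtain `Z_{L;β}(h*)² ≤ Z_{L;β}(h^{*,+}) Z_{L;β}(h^{*,-})`"), for any reflection `θ` of
a finite graph with positive half `𝕋₊` (involutive automorphism exchanging `𝕋₊` and its
complement, crossing edges `{x, θx}`), `β ≥ 0`, and a finite compactly supported single-spin
measure. [cite: FriedliVelenik2017, §10.5.3, proof of Prop. 10.27] -/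
theorem vZ_sq_le_reflect (hθ : ∀ x, θ (θ x) = x) (hadj : ∀ x y, G.Adj (θ x) (θ y) ↔ G.Adj x y)
    (hP : ∀ x, x ∈ P ↔ θ x ∉ P) (hcross : ∀ x y, x ∈ P → y ∉ P → G.Adj x y → y = θ x)
    (ρ : Measure (Fin ν → ℝ)) [IsFiniteMeasure ρ] {K : Set (Fin ν → ℝ)} (hKc : IsCompact K)
    (hK : ρ Kᶜ = 0) {β : ℝ} (hβ : 0 ≤ β) (h : V → Fin ν → ℝ) :
    vZ G ρ β h ^ 2 ≤ vZ G ρ β (reflPlus θ P h) * vZ G ρ β (reflMinus θ P h) := by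
  rw [vZ_eq_pairInt hθ hadj hP hcross ρ β h, vZ_eq_pairInt hθ hadj hP hcross ρ β (reflPlus θ P h),
    vZ_eq_pairInt hθ hadj hP hcross ρ β (reflMinus θ P h)]
  have hplus : pairInt G θ P ρ β (reflPlus θ P h) (reflPlus θ P h ∘ θ) = pairInt G θ P ρ β h h := by
    refine pairInt_congr ρ β (fun x hx => by simp [reflPlus, hx]) (fun x hx => ?_)
    have hθx : θ x ∉ P := (hP x).1 hx
    simp [reflPlus, hθx, hθ]
  have hminus : pairInt G θ P ρ β (reflMinus θ P h) (reflMinus θ P h ∘ θ) =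
      pairInt G θ P ρ β (h ∘ θ) (h ∘ θ) := by
    refine pairInt_congr ρ β (fun x hx => by simp [reflMinus, hx]) (fun x hx => ?_)
    have hθx : θ x ∉ P := (hP x).1 hx
    simp [reflMinus, hθx]
  rw [hplus, hminus]
  exact pairInt_sq_le ρ hKc hK hβ h (h ∘ θ)

end Reflection

/-! ### Gaussian domination by descent on the number of bad bonds (Prop. 10.27) -/

section Descent

variable {V : Type*} [Fintype V] [DecidableEq V] {G : SimpleGraph V} [DecidableRel G.Adj] {ν : ℕ}

/-- The bad-bond indicator of a vector field `g` on an unordered pair: `1` if `g x ≠ g y`, else `0`.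
[cite: FriedliVelenik2017, §10.5.3, proof of Prop. 10.27] -/
def vbadInd (g : V → Fin ν → ℝ) : Sym2 V → ℕ :=
  Sym2.lift ⟨fun x y => if g x = g y then (0 : ℕ) else 1, fun x y => by
    by_cases h : g x = g y <;> simp [h, eq_comm]⟩

/-- The number of *bad bonds* `N(g) = #{{x,y} ∈ E : g_x ≠ g_y}` of a vector field
(Friedli–Velenik 2017, proof of Prop. 10.27). [cite: FriedliVelenik2017, §10.5.3, proof of Prop. 10.27] -/
def vbadBonds (G : SimpleGraph V) [DecidableRel G.Adj] (g : V → Fin ν → ℝ) : ℕ :=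
  ∑ e ∈ G.edgeFinset, vbadInd g e

omit [Fintype V] [DecidableEq V] in
/-- Value of the bad-bond indicator on `s(x, y)`. [folklore] -/
@[simp] theorem vbadInd_mk (g : V → Fin ν → ℝ) (x y : V) :
    vbadInd g s(x, y) = if g x = g y then 0 else 1 := rfl

omit [DecidableEq V] in
/-- A field without bad bonds does not change `Z`: `N(g) = 0 ⇒ Z(g) = Z(0)`
(Friedli–Velenik 2017, proof of Prop. 10.27). [cite: FriedliVelenik2017, §10.5.3, proof of Prop. 10.27] -/
theorem vZ_eq_vZ_zero_of_vbadBonds_eq_zero (ρ : Measure (Fin ν → ℝ)) (β : ℝ) {g : V → Fin ν → ℝ}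
    (hg : vbadBonds G g = 0) : vZ G ρ β g = vZ G ρ β 0 := by
  unfold vZ
  refine integral_congr_ae (ae_of_all _ fun ω => ?_)
  simp only
  congr 2
  rw [vecGradForm_eq_sum, vecGradForm_eq_sum]
  refine Finset.sum_congr rfl fun e he => ?_
  have hterm := (Finset.sum_eq_zero_iff.1 hg) e he
  induction e using Sym2.ind with
  | _ x y =>
    rw [vbadInd_mk] at hterm
    have hxy : g x = g y := by
      by_contra h
      rw [if_neg h] at hterm
      exact one_ne_zero hterm
    simp only [Sym2.lift_mk, Pi.add_apply, Pi.zero_apply, add_zero, hxy]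
    exact Finset.sum_congr rfl fun a _ => by ring

variable {θ : V ≃ V} {P : Finset V}

/-- **The bad-bond count of the symmetrised fields** (Friedli–Velenik 2017, proof of Prop. 10.27:
`min{N(h^{*,+}), N(h^{*,-})} < N(h*)` when a bad bond crosses the mirror; here the exact identity
`N(h⁺) + N(h⁻) + 2N_C(h) = 2N(h)` with `N_C` the number of bad crossing bonds). [cite: FriedliVelenik2017, §10.5.3, proof of Prop. 10.27] -/
theorem vbadBonds_reflPlus_add_reflMinus (hθ : ∀ x, θ (θ x) = x)
    (hadj : ∀ x y, G.Adj (θ x) (θ y) ↔ G.Adj x y) (hP : ∀ x, x ∈ P ↔ θ x ∉ P)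
    (hcross : ∀ x y, x ∈ P → y ∉ P → G.Adj x y → y = θ x) (g : V → Fin ν → ℝ) :
    vbadBonds G (reflPlus θ P g) + vbadBonds G (reflMinus θ P g) +
        2 * ∑ x ∈ crossSites G θ P, vbadInd g s(x, θ x) =
      2 * vbadBonds G g := by
  unfold vbadBonds
  rw [sum_edgeFinset_reflect_split hθ hadj hP hcross (vbadInd (reflPlus θ P g)),
    sum_edgeFinset_reflect_split hθ hadj hP hcross (vbadInd (reflMinus θ P g)),
    sum_edgeFinset_reflect_split hθ hadj hP hcross (vbadInd g)]
  have hinP : ∑ e ∈ innerEdges G P, vbadInd (reflPlus θ P g) e = ∑ e ∈ innerEdges G P, vbadInd g e := by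
    refine Finset.sum_congr rfl fun e he => ?_
    induction e using Sym2.ind with
    | _ a b =>
      have ha : a ∈ P := mem_of_mem_innerEdges he (Sym2.mem_mk_left a b)
      have hb : b ∈ P := mem_of_mem_innerEdges he (Sym2.mem_mk_right a b)
      simp [reflPlus, ha, hb]
  have houtP : ∑ e ∈ innerEdges G P, vbadInd (reflPlus θ P g) (Sym2.map θ e) =
      ∑ e ∈ innerEdges G P, vbadInd g e := by
    refine Finset.sum_congr rfl fun e he => ?_
    induction e using Sym2.ind with
    | _ a b =>
      have ha : θ a ∉ P := (hP a).1 (mem_of_mem_innerEdges he (Sym2.mem_mk_left a b))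
      have hb : θ b ∉ P := (hP b).1 (mem_of_mem_innerEdges he (Sym2.mem_mk_right a b))
      simp [reflPlus, ha, hb, hθ]
  have hcrP : ∑ x ∈ crossSites G θ P, vbadInd (reflPlus θ P g) s(x, θ x) = 0 := by
    refine Finset.sum_eq_zero fun x hx => ?_
    have hxP : x ∈ P := mem_of_mem_crossSites hx
    have hθx : θ x ∉ P := (hP x).1 hxP
    simp [reflPlus, hxP, hθx, hθ]
  have hinM : ∑ e ∈ innerEdges G P, vbadInd (reflMinus θ P g) e =
      ∑ e ∈ innerEdges G P, vbadInd g (Sym2.map θ e) := by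
    refine Finset.sum_congr rfl fun e he => ?_
    induction e using Sym2.ind with
    | _ a b =>
      have ha : a ∈ P := mem_of_mem_innerEdges he (Sym2.mem_mk_left a b)
      have hb : b ∈ P := mem_of_mem_innerEdges he (Sym2.mem_mk_right a b)
      simp [reflMinus, ha, hb]
  have houtM : ∑ e ∈ innerEdges G P, vbadInd (reflMinus θ P g) (Sym2.map θ e) =
      ∑ e ∈ innerEdges G P, vbadInd g (Sym2.map θ e) := by
    refine Finset.sum_congr rfl fun e he => ?_
    induction e using Sym2.ind with
    | _ a b =>
      have ha : θ a ∉ P := (hP a).1 (mem_of_mem_innerEdges he (Sym2.mem_mk_left a b))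
      have hb : θ b ∉ P := (hP b).1 (mem_of_mem_innerEdges he (Sym2.mem_mk_right a b))
      simp [reflMinus, ha, hb]
  have hcrM : ∑ x ∈ crossSites G θ P, vbadInd (reflMinus θ P g) s(x, θ x) = 0 := by
    refine Finset.sum_eq_zero fun x hx => ?_
    have hxP : x ∈ P := mem_of_mem_crossSites hx
    have hθx : θ x ∉ P := (hP x).1 hxP
    simp [reflMinus, hxP, hθx]
  rw [hinP, houtP, hcrP, hinM, houtM, hcrM]
  ring

/-- The symmetrised fields take values among the values of the field. [folklore] -/
theorem reflPlus_mem_piFinset {R : Finset (Fin ν → ℝ)} {g : V → Fin ν → ℝ}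
    (hg : g ∈ Fintype.piFinset fun _ => R) :
    reflPlus θ P g ∈ Fintype.piFinset fun _ => R := by
  rw [Fintype.mem_piFinset] at hg ⊢
  intro x
  unfold reflPlus
  split_ifs
  · exact hg x
  · exact hg (θ x)

/-- The symmetrised fields take values among the values of the field. [folklore] -/
theorem reflMinus_mem_piFinset {R : Finset (Fin ν → ℝ)} {g : V → Fin ν → ℝ}
    (hg : g ∈ Fintype.piFinset fun _ => R) :
    reflMinus θ P g ∈ Fintype.piFinset fun _ => R := by
  rw [Fintype.mem_piFinset] at hg ⊢
  intro x
  unfold reflMinus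
  split_ifs
  · exact hg (θ x)
  · exact hg x

end Descent

section TorusDescent

variable {d L : ℕ} [NeZero L] {ν : ℕ}

/-- **Gaussian domination on the even torus** (Friedli–Velenik 2017, Prop. 10.27, eq. (10.43):
"For all `h = (h_i)_{i ∈ 𝕋_L}`, `Z_{L;β}(h) ≤ Z_{L;β}(0)`"), for `ν`-component spins with a finite,
nonzero, compactly supported single-spin measure, `L` even, `L ≥ 4`, `β ≥ 0`. Proof by the printed
descent (p. 505) run, as in the tree's Ising `gaussZ_le_gaussZ_zero`, on the finite set of fields
taking values in the range of `h`: among the maximisers `g` of `Z` on this set choose one with the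
fewest bad bonds; if a bond `{x, x + eᵢ}` were bad, the reflection between sites bisecting it would
give `Z(g)² ≤ Z(g⁺)Z(g⁻)` (`vZ_sq_le_reflect`), so `g⁺, g⁻` are again maximisers, while
`N(g⁺) + N(g⁻) ≤ 2N(g) - 2` — a contradiction; hence `N(g) = 0` and `Z(h) ≤ Z(g) = Z(0)`.
(Deviation from the printed compactness argument for the existence of a maximiser: the finite
descent of Kennedy–Lieb–Shastry, as in `GaussianDominationProofs.lean`.) [cite: FriedliVelenik2017, Prop. 10.27, eq. (10.43)] -/
theorem vZ_le_vZ_zero (hL : Even L) (hL4 : 4 ≤ L) (ρ : Measure (Fin ν → ℝ)) [IsFiniteMeasure ρ]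
    {K : Set (Fin ν → ℝ)} (hKc : IsCompact K) (hK : ρ Kᶜ = 0) (hρ : ρ ≠ 0) {β : ℝ} (hβ : 0 ≤ β)
    (h : TorusSite d L → Fin ν → ℝ) :
    vZ (torusGraph d L) ρ β h ≤ vZ (torusGraph d L) ρ β 0 := by
  classical
  set Gr := torusGraph d L
  -- the finite set of fields with values in the range of `h`
  set R : Finset (Fin ν → ℝ) := Finset.univ.image h with hR
  set F : Finset (TorusSite d L → Fin ν → ℝ) := Fintype.piFinset fun _ => R with hF
  have hhF : h ∈ F := by
    rw [hF, Fintype.mem_piFinset]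
    intro x
    exact Finset.mem_image_of_mem h (Finset.mem_univ x)
  have hFne : F.Nonempty := ⟨h, hhF⟩
  -- a maximiser of `Z` on `F`
  obtain ⟨g₀, hg₀F, hg₀max⟩ := Finset.exists_max_image F (vZ Gr ρ β) hFne
  set Fmax := F.filter fun g => vZ Gr ρ β g = vZ Gr ρ β g₀ with hFmax
  have hFmaxne : Fmax.Nonempty := ⟨g₀, by simp [hFmax, hg₀F]⟩
  -- among the maximisers, one with the fewest bad bonds
  obtain ⟨g, hgFmax, hgmin⟩ := Finset.exists_min_image Fmax (vbadBonds Gr) hFmaxne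
  obtain ⟨hgF, hgZ⟩ := Finset.mem_filter.1 hgFmax
  have hgmax : ∀ g' ∈ F, vZ Gr ρ β g' ≤ vZ Gr ρ β g := fun g' hg' => hgZ ▸ hg₀max g' hg'
  -- claim: `g` has no bad bond
  have hN : vbadBonds Gr g = 0 := by
    by_contra hN0
    obtain ⟨e, he, hbad⟩ : ∃ e ∈ Gr.edgeFinset, vbadInd g e ≠ 0 := by
      by_contra hall
      push Not at hall
      exact hN0 (Finset.sum_eq_zero hall)
    have hL3 : 3 ≤ L := by omega
    obtain ⟨x, i, hxy⟩ : ∃ (x : TorusSite d L) (i : Fin d), e = s(x, x + Pi.single i 1) := by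
      induction e using Sym2.ind with
      | _ a b =>
        have hab : Gr.Adj a b := (SimpleGraph.mem_edgeFinset.1 he)
        rw [torusGraph_adj_iff] at hab
        rcases hab.2 with ⟨i, rfl⟩ | ⟨i, rfl⟩
        · exact ⟨a, i, rfl⟩
        · exact ⟨b, i, Sym2.eq_swap⟩
    subst hxy
    rw [vbadInd_mk] at hbad
    have hgx : g x ≠ g (x + Pi.single i 1) := by
      intro h'; rw [if_pos h'] at hbad; exact hbad rfl
    -- the reflection bisecting this bond
    set θ := Torus.reflectBetweenSites (d := d) (L := L) i (x i) with hθdef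
    set P := (Torus.halfBetweenSites (d := d) (L := L) i (x i)).toFinset with hPdef
    have hθθ : ∀ z, θ (θ z) = z := Torus.reflectBetweenSites_involutive i (x i)
    have hadj : ∀ a b, Gr.Adj (θ a) (θ b) ↔ Gr.Adj a b :=
      Torus.torusGraph_adj_reflectBetweenSites_iff i (x i)
    have hP : ∀ a, a ∈ P ↔ θ a ∉ P :=
      Torus.mem_halfBetweenSites_iff_reflect_not_mem hL i (x i)
    have hcross : ∀ a b, a ∈ P → b ∉ P → Gr.Adj a b → b = θ a := fun a b ha hb hab =>
      Torus.eq_reflectBetweenSites_of_adj hL hL4 i (x i) ha hb hab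
    obtain ⟨hyP, hθy⟩ := Torus.add_single_mem_halfBetweenSites (by omega : 2 ≤ L) i x
    -- `Z(g)² ≤ Z(g⁺) Z(g⁻)` and both are at most `Z(g)`, so both equal `Z(g)`
    have hsq := vZ_sq_le_reflect (G := Gr) hθθ hadj hP hcross ρ hKc hK hβ g
    have hPF : reflPlus θ P g ∈ F := reflPlus_mem_piFinset hgF
    have hMF : reflMinus θ P g ∈ F := reflMinus_mem_piFinset hgF
    have hPle := hgmax _ hPF
    have hMle := hgmax _ hMF
    have hZpos := vZ_pos (G := Gr) hρ hβ g
    have hPpos := vZ_pos (G := Gr) hρ hβ (reflPlus θ P g)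
    have hMpos := vZ_pos (G := Gr) hρ hβ (reflMinus θ P g)
    have hPeq : vZ Gr ρ β (reflPlus θ P g) = vZ Gr ρ β g := by
      refine le_antisymm hPle ?_
      by_contra hlt
      push Not at hlt
      have : vZ Gr ρ β (reflPlus θ P g) * vZ Gr ρ β (reflMinus θ P g) <
          vZ Gr ρ β g * vZ Gr ρ β g :=
        mul_lt_mul hlt hMle hMpos hZpos.le
      nlinarith
    have hMeq : vZ Gr ρ β (reflMinus θ P g) = vZ Gr ρ β g := by
      refine le_antisymm hMle ?_
      by_contra hlt
      push Not at hlt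
      have : vZ Gr ρ β (reflPlus θ P g) * vZ Gr ρ β (reflMinus θ P g) <
          vZ Gr ρ β g * vZ Gr ρ β g :=
        mul_lt_mul' hPle hlt hMpos.le hZpos
      nlinarith
    -- so `g⁺, g⁻` are maximisers, and minimality of `N(g)` gives `N(g) ≤ N(g±)`
    have hPmin : vbadBonds Gr g ≤ vbadBonds Gr (reflPlus θ P g) :=
      hgmin _ (Finset.mem_filter.2 ⟨hPF, hPeq.trans hgZ⟩)
    have hMmin : vbadBonds Gr g ≤ vbadBonds Gr (reflMinus θ P g) :=
      hgmin _ (Finset.mem_filter.2 ⟨hMF, hMeq.trans hgZ⟩)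
    -- but the bisected bad bond is a crossing bond: `N(g⁺) + N(g⁻) ≤ 2N(g) - 2`
    have hcount := vbadBonds_reflPlus_add_reflMinus (G := Gr) hθθ hadj hP hcross g
    have hycross : x + Pi.single i 1 ∈ crossSites Gr θ P := by
      refine Finset.mem_filter.2 ⟨hyP, ?_⟩
      rw [hθy]
      exact (torusGraph_adj_add_single (by omega) x i).symm
    have hone : (1 : ℕ) ≤ ∑ z ∈ crossSites Gr θ P, vbadInd g s(z, θ z) := by
      calc (1 : ℕ) = vbadInd g s(x + Pi.single i 1, θ (x + Pi.single i 1)) := by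
            rw [vbadInd_mk, hθy, if_neg (Ne.symm hgx)]
        _ ≤ ∑ z ∈ crossSites Gr θ P, vbadInd g s(z, θ z) :=
          Finset.single_le_sum (f := fun z => vbadInd g s(z, θ z)) (fun z _ => Nat.zero_le _) hycross
    omega
  calc vZ Gr ρ β h ≤ vZ Gr ρ β g := hgmax h hhF
    _ = vZ Gr ρ β 0 := vZ_eq_vZ_zero_of_vbadBonds_eq_zero ρ β hN

end TorusDescent

/-! ### The second-order consequence of Gaussian domination ((10.46)–(10.47)) -/

section SecondOrder

variable {V : Type*} [Fintype V] {G : SimpleGraph V} [DecidableRel G.Adj] {ν : ℕ}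
  (ρ : Measure (Fin ν → ℝ))

/-- `Z(t h)` expanded around the configuration: with `w(ω) = e^{-β𝓔(ω,ω)}` and `A_h(ω) = 𝓔(ω,h)`,
`Z(th) = e^{-βt²𝓔(h,h)} ∫ w(ω) e^{-2βt A_h(ω)} dμ₀` (Friedli–Velenik 2017, proof of Thm. 10.24,
"elementary computations"). [cite: FriedliVelenik2017, §10.5.3, proof of Thm. 10.24] -/
theorem vZ_smul (β t : ℝ) (h : V → Fin ν → ℝ) :
    vZ G ρ β (t • h) = Real.exp (-β * t ^ 2 * vecGradForm G h h) *
      ∫ ω, Real.exp (-β * vecGradForm G ω ω) * Real.exp (-2 * β * t * vecGradForm G ω h)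
        ∂(Measure.pi fun _ : V => ρ) := by
  unfold vZ
  rw [← integral_const_mul]
  refine integral_congr_ae (ae_of_all _ fun ω => ?_)
  simp only
  rw [vecGradForm_add_smul_self, ← Real.exp_add, ← Real.exp_add]
  congr 1
  ring

/-- `Z(0) = ∫ w dμ₀`. [folklore] -/
theorem vZ_zero (β : ℝ) :
    vZ G ρ β 0 = ∫ ω, Real.exp (-β * vecGradForm G ω ω) ∂(Measure.pi fun _ : V => ρ) := by
  unfold vZ
  simp only [add_zero]

/-- `e^{x} + e^{-x} ≥ 2 + x²`. [folklore] -/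
theorem two_add_sq_le_exp_add_exp_neg (x : ℝ) : 2 + x ^ 2 ≤ Real.exp x + Real.exp (-x) := by
  have h := one_add_sq_div_two_le_cosh x
  rw [Real.cosh_eq] at h
  linarith

variable [IsFiniteMeasure ρ]

/-- **The second-order consequence of Gaussian domination** (Friedli–Velenik 2017, proof of
Thm. 10.24, (10.46)–(10.47)): if `Z(th) ≤ Z(0)` for all real `t` and `β > 0`, then
`2β ∫ w(ω) 𝓔(ω,h)² dμ₀ ≤ 𝓔(h,h) ∫ w dμ₀` with `w(ω) = e^{-β𝓔(ω,ω)}`, i.e.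
`⟨(∑_{{i,j}} (S_i - S_j)·(h_i - h_j))²⟩_{L;β} ≤ (2β)⁻¹ ∑_{{i,j}} ‖h_i - h_j‖²` ((10.47)). Instead of
differentiating twice we use `Z(th) + Z(-th) ≤ 2Z(0)` and `e^x + e^{-x} ≥ 2 + x²` to get
`Z(0) + 2β²t² ∫ w 𝓔(ω,h)² ≤ e^{βt²𝓔(h,h)} Z(0)`, and expand to first order in `t²`.
[cite: FriedliVelenik2017, §10.5.3, proof of Thm. 10.24, (10.46)–(10.47)] -/
theorem integral_weight_vecGradForm_sq_le {K : Set (Fin ν → ℝ)} (hKc : IsCompact K)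
    (hK : ρ Kᶜ = 0) (hρ : ρ ≠ 0) {β : ℝ} (hβ : 0 < β) (h : V → Fin ν → ℝ)
    (hGD : ∀ t : ℝ, vZ G ρ β (t • h) ≤ vZ G ρ β 0) :
    2 * β * ∫ ω, Real.exp (-β * vecGradForm G ω ω) * vecGradForm G ω h ^ 2
        ∂(Measure.pi fun _ : V => ρ) ≤
      vecGradForm G h h * ∫ ω, Real.exp (-β * vecGradForm G ω ω) ∂(Measure.pi fun _ : V => ρ) := by
  set μ₀ : Measure (V → Fin ν → ℝ) := Measure.pi fun _ : V => ρ with hμ₀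
  set w : (V → Fin ν → ℝ) → ℝ := fun ω => Real.exp (-β * vecGradForm G ω ω) with hw
  set A : (V → Fin ν → ℝ) → ℝ := fun ω => vecGradForm G ω h with hA
  set B : ℝ := vecGradForm G h h with hB
  set Z₀ : ℝ := ∫ ω, w ω ∂μ₀ with hZ₀
  set S : ℝ := ∫ ω, w ω * A ω ^ 2 ∂μ₀ with hS
  show 2 * β * S ≤ B * Z₀
  have hwc : Continuous w := ((continuous_vecGradForm_self (G := G)).const_mul (-β)).rexp
  have hAc : Continuous A := continuous_vecGradForm_left (G := G) h
  have hint : ∀ {f : (V → Fin ν → ℝ) → ℝ}, Continuous f → Integrable f μ₀ := fun hf =>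
    integrable_pi_of_continuous ρ hKc hK hf
  have hw_pos : ∀ ω, 0 < w ω := fun ω => Real.exp_pos _
  have hZ₀_pos : 0 < Z₀ := by
    have := vZ_pos (G := G) hρ hβ.le (0 : V → Fin ν → ℝ)
    rwa [vZ_zero] at this
  have hS0 : 0 ≤ S := integral_nonneg fun ω => mul_nonneg (hw_pos ω).le (sq_nonneg _)
  have hB0 : 0 ≤ B := vecGradForm_self_nonneg h
  have hZ0 : vZ G ρ β 0 = Z₀ := vZ_zero ρ β
  -- the lower bound `Z(th) + Z(-th) ≥ e^{-βt²B} (2Z₀ + 4β²t² S)`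
  have hlow : ∀ t : ℝ, Real.exp (-β * t ^ 2 * B) * (2 * Z₀ + 4 * β ^ 2 * t ^ 2 * S) ≤
      vZ G ρ β (t • h) + vZ G ρ β ((-t) • h) := by
    intro t
    rw [vZ_smul, vZ_smul, show (-t) ^ 2 = t ^ 2 by ring, ← mul_add]
    refine mul_le_mul_of_nonneg_left ?_ (Real.exp_pos _).le
    have hi1 : Integrable (fun ω => w ω * Real.exp (-2 * β * t * A ω)) μ₀ := hint (by fun_prop)
    have hi2 : Integrable (fun ω => w ω * Real.exp (-2 * β * -t * A ω)) μ₀ := hint (by fun_prop)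
    have hi3 : Integrable (fun ω => w ω * (2 + (2 * β * t * A ω) ^ 2)) μ₀ := hint (by fun_prop)
    rw [← integral_add hi1 hi2]
    calc 2 * Z₀ + 4 * β ^ 2 * t ^ 2 * S = ∫ ω, w ω * (2 + (2 * β * t * A ω) ^ 2) ∂μ₀ := by
          rw [hZ₀, hS, ← integral_const_mul, ← integral_const_mul, ← integral_add
            ((hint hwc).const_mul _) ((hint (by fun_prop)).const_mul _)]
          refine integral_congr_ae (ae_of_all _ fun ω => ?_)
          simp only
          ring
      _ ≤ ∫ ω, w ω * Real.exp (-2 * β * t * A ω) + w ω * Real.exp (-2 * β * -t * A ω) ∂μ₀ := by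
          refine integral_mono hi3 (hi1.add hi2) fun ω => ?_
          simp only
          rw [← mul_add]
          refine mul_le_mul_of_nonneg_left ?_ (hw_pos ω).le
          have e1 : -2 * β * t * A ω = -(2 * β * t * A ω) := by ring
          have e2 : -2 * β * -t * A ω = 2 * β * t * A ω := by ring
          rw [e1, e2, add_comm (Real.exp _)]
          exact two_add_sq_le_exp_add_exp_neg _
  -- hence `Z₀ + 2β² S u ≤ Z₀ e^{βBu}` for `u ≥ 0`
  have hphi : ∀ u : ℝ, 0 ≤ u → Z₀ + 2 * β ^ 2 * S * u ≤ Z₀ * Real.exp (β * B * u) := by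
    intro u hu
    have h1 := (hlow (Real.sqrt u)).trans (add_le_add (hGD _) (hGD _))
    rw [Real.sq_sqrt hu, hZ0] at h1
    have hexp : Real.exp (-β * u * B) * Real.exp (β * B * u) = 1 := by
      rw [← Real.exp_add]; convert Real.exp_zero using 2; ring
    have h2 := mul_le_mul_of_nonneg_right h1 (Real.exp_pos (β * B * u)).le
    have h3 : Real.exp (-β * u * B) * (2 * Z₀ + 4 * β ^ 2 * u * S) * Real.exp (β * B * u) =
        2 * (Z₀ + 2 * β ^ 2 * S * u) := by
      calc Real.exp (-β * u * B) * (2 * Z₀ + 4 * β ^ 2 * u * S) * Real.exp (β * B * u)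
          = (2 * Z₀ + 4 * β ^ 2 * u * S) * (Real.exp (-β * u * B) * Real.exp (β * B * u)) := by ring
        _ = 2 * (Z₀ + 2 * β ^ 2 * S * u) := by rw [hexp]; ring
    rw [h3] at h2
    linarith
  -- first-order expansion at `u = 0`
  by_contra hcon
  push Not at hcon
  set c : ℝ := β * B with hc
  have hlt : Z₀ * c < 2 * β ^ 2 * S := by
    rw [hc]; nlinarith
  have hderiv : HasDerivAt (fun u : ℝ => Z₀ * Real.exp (c * u)) (Z₀ * c) 0 := by
    have h1 : HasDerivAt (fun u : ℝ => c * u) c 0 := by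
      simpa using (hasDerivAt_id (0 : ℝ)).const_mul c
    have h2 := (Real.hasDerivAt_exp (c * 0)).comp 0 h1
    simp only [mul_zero, Real.exp_zero, one_mul] at h2
    simpa using h2.const_mul Z₀
  rw [hasDerivAt_iff_tendsto_slope_zero] at hderiv
  have hev : ∀ᶠ u : ℝ in 𝓝[>] 0, u⁻¹ * (Z₀ * Real.exp (c * u) - Z₀) < 2 * β ^ 2 * S := by
    have ht := hderiv.mono_left (nhdsGT_le_nhdsNE 0)
    simp only [zero_add, mul_zero, Real.exp_zero, mul_one, smul_eq_mul] at ht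
    exact ht.eventually (gt_mem_nhds hlt)
  obtain ⟨u, hu, hupos⟩ := (hev.and self_mem_nhdsWithin).exists
  have hupos' : (0 : ℝ) < u := hupos
  have h3 := hphi u hupos'.le
  have h4 : Z₀ * Real.exp (c * u) - Z₀ < 2 * β ^ 2 * S * u := by
    have := (inv_mul_lt_iff₀ hupos').1 hu
    linarith
  rw [hc] at h4
  have : β * B * u = (β * B) * u := by ring
  rw [this] at h3
  linarith

end SecondOrder

/-! ### Plane waves on the torus (proof of Thm. 10.24) -/

section PlaneWaves

open _root_.Complex
open scoped ComplexConjugate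

variable {d L : ℕ} [NeZero L]

/-- **`𝓔(f, χ_k) = 2ε(p_k) ∑_x f_x χ_k(x)`** for a real function `f` on the torus and the plane wave
`χ_k` (Friedli–Velenik 2017, proof of Thm. 10.24:
`∑_{{i,j}} (S_i - S_j)(h_i - h_j) = ∑_i S_i (-Δα)_i = 2d{1 - (2d)⁻¹∑_{j∼0} cos(p·j)} ∑_i S_i e^{ip·i}`,
and `2d{…} = 2ε(p)`), `L ≥ 3`; the tree's `gradFormC_torusChar` for an arbitrary real `f`.
[cite: FriedliVelenik2017, §10.5.3, proof of Thm. 10.24] -/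
theorem gradFormC_torusChar_fun (hL : 3 ≤ L) (k : TorusSite d L) (f : TorusSite d L → ℝ) :
    gradFormC (torusGraph d L) f (torusChar k) =
      ((2 * dispersion (latticeMomentum L k) : ℝ) : ℂ) * ∑ x, (f x : ℂ) * torusChar k x := by
  classical
  have hL2 : 2 ≤ L := by omega
  unfold gradFormC
  rw [sum_edgeFinset_torusGraph hL]
  simp only [Sym2.lift_mk]
  set M : ℂ := ∑ x, (f x : ℂ) * torusChar k x with hM
  set u : Fin d → ℂ := fun i => Complex.exp (latticeMomentum L k i * I) with hu
  have hχ : ∀ x i, torusChar k (x + Pi.single i 1) = torusChar k x * u i := fun x i => by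
    rw [torusChar_add_right, torusChar_single hL2]
  have hshift : ∀ i, ∑ x, (f (x + Pi.single i 1) : ℂ) * torusChar k x = conj (u i) * M := by
    intro i
    rw [hM, Finset.mul_sum, ← Equiv.sum_comp (Equiv.addRight (Pi.single i 1))
      (fun x => conj (u i) * ((f x : ℂ) * torusChar k x))]
    refine Finset.sum_congr rfl fun x _ => ?_
    simp only [Equiv.coe_addRight, hχ]
    have hu1 : conj (u i) * u i = 1 := by
      rw [mul_comm, Complex.mul_conj, hu]
      simp [Complex.normSq_eq_norm_sq, Complex.norm_exp_ofReal_mul_I]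
    calc (f (x + Pi.single i 1) : ℂ) * torusChar k x
        = (f (x + Pi.single i 1) : ℂ) * torusChar k x * (conj (u i) * u i) := by rw [hu1, mul_one]
      _ = conj (u i) * ((f (x + Pi.single i 1) : ℂ) * (torusChar k x * u i)) := by ring
  have hterm : ∀ x i, (((f x - f (x + Pi.single i 1) : ℝ)) : ℂ) *
      (torusChar k x - torusChar k (x + Pi.single i 1)) =
        (1 - u i) * ((f x : ℂ) * torusChar k x) -
          (1 - u i) * ((f (x + Pi.single i 1) : ℂ) * torusChar k x) := by
    intro x i; rw [hχ]; push_cast; ring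
  have hi : ∀ i, ∑ x, (((f x - f (x + Pi.single i 1) : ℝ)) : ℂ) *
      (torusChar k x - torusChar k (x + Pi.single i 1)) = (1 - u i) * (1 - conj (u i)) * M := by
    intro i
    calc ∑ x, (((f x - f (x + Pi.single i 1) : ℝ)) : ℂ) *
          (torusChar k x - torusChar k (x + Pi.single i 1))
        = ∑ x, ((1 - u i) * ((f x : ℂ) * torusChar k x) -
            (1 - u i) * ((f (x + Pi.single i 1) : ℂ) * torusChar k x)) :=
          Finset.sum_congr rfl fun x _ => hterm x i
      _ = (1 - u i) * ∑ x, (f x : ℂ) * torusChar k x -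
            (1 - u i) * ∑ x, (f (x + Pi.single i 1) : ℂ) * torusChar k x := by
          rw [Finset.sum_sub_distrib, Finset.mul_sum, Finset.mul_sum]
      _ = (1 - u i) * M - (1 - u i) * (conj (u i) * M) := by rw [hshift]
      _ = (1 - u i) * (1 - conj (u i)) * M := by ring
  have hsum : ∑ i, (1 - u i) * (1 - conj (u i)) =
      ((2 * dispersion (latticeMomentum L k) : ℝ) : ℂ) := by
    unfold dispersion
    push_cast
    rw [Finset.mul_sum]
    refine Finset.sum_congr rfl fun i _ => ?_
    have := one_sub_mul_one_sub_conj_exp (latticeMomentum L k i)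
    rw [hu]
    push_cast at this ⊢
    exact this
  rw [Finset.sum_comm]
  calc ∑ i, ∑ x, (((f x - f (x + Pi.single i 1) : ℝ)) : ℂ) *
        (torusChar k x - torusChar k (x + Pi.single i 1))
      = ∑ i, (1 - u i) * (1 - conj (u i)) * M := Finset.sum_congr rfl fun i _ => hi i
    _ = (∑ i, (1 - u i) * (1 - conj (u i))) * M := by rw [Finset.sum_mul]
    _ = ((2 * dispersion (latticeMomentum L k) : ℝ) : ℂ) * M := by rw [hsum]

variable {V : Type*} [Fintype V] {G : SimpleGraph V} [DecidableRel G.Adj] {ν : ℕ}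

/-- The field `h_x = r(x) e_a` pointing in the `a`-th spin direction (Friedli–Velenik 2017, proof of
Thm. 10.24: `h_j = α_j e_ℓ`). [cite: FriedliVelenik2017, §10.5.3, proof of Thm. 10.24] -/
def planeField (a : Fin ν) (r : V → ℝ) : V → Fin ν → ℝ := fun x b => if b = a then r x else 0

/-- The bond form against the zero function vanishes. [folklore] -/
theorem gradForm_zero_right (f : V → ℝ) : gradForm G f (fun _ => 0) = 0 := by
  unfold gradForm
  refine Finset.sum_eq_zero fun e _ => ?_
  induction e using Sym2.ind with
  | _ x y => simp

/-- `𝓔(f, r e_a) = 𝓔(f^a, r)`. [folklore] -/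
theorem vecGradForm_planeField_right (f : V → Fin ν → ℝ) (a : Fin ν) (r : V → ℝ) :
    vecGradForm G f (planeField a r) = gradForm G (fun x => f x a) r := by
  unfold vecGradForm
  rw [Finset.sum_eq_single a (fun b _ hb => ?_) (fun ha => absurd (Finset.mem_univ a) ha)]
  · simp only [planeField, if_true]
  · simp only [planeField, if_neg hb]
    exact gradForm_zero_right _

/-- `𝓔(r e_a, r e_a) = 𝓔(r, r)`. [folklore] -/
theorem vecGradForm_planeField_self (a : Fin ν) (r : V → ℝ) :
    vecGradForm G (planeField a r) (planeField a r) = gradForm G r r := by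
  rw [vecGradForm_planeField_right]
  simp only [planeField, if_true]

/-- **The infrared bound per spin component, in weighted form** (Friedli–Velenik 2017, proof of
Thm. 10.24: `⟨|∑_i S_i^ℓ e^{ip·i}|²⟩_{L;β} ≤ |𝕋_L| (4dβ{1 - (2d)⁻¹∑_{j∼0}cos(p·j)})⁻¹ = |𝕋_L|/(4βε(p))`):
with `w(ω) = e^{-β𝓔(ω,ω)}`, `4βε(p_k) ∫ w(ω)|∑_x ω_x^a χ_k(x)|² dμ₀ ≤ L^d ∫ w dμ₀`, from the
second-order inequality for the real and imaginary parts of the plane wave `χ_k e_a`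
(`𝓔(ω, χ_k e_a) = 2ε Ŝ^a_k`, `∑‖χ_k(x) - χ_k(y)‖² = 2L^dε`). [cite: FriedliVelenik2017, Thm. 10.24, proof pp. 506–507] -/
theorem weighted_mode_bound (hL : Even L) (hL4 : 4 ≤ L) (ρ : Measure (Fin ν → ℝ))
    [IsFiniteMeasure ρ] {K : Set (Fin ν → ℝ)} (hKc : IsCompact K) (hK : ρ Kᶜ = 0) (hρ : ρ ≠ 0)
    {β : ℝ} (hβ : 0 < β) (k : TorusSite d L) (hε : 0 < dispersion (latticeMomentum L k))
    (a : Fin ν) :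
    4 * β * dispersion (latticeMomentum L k) *
        ∫ ω, Real.exp (-β * vecGradForm (torusGraph d L) ω ω) *
          ‖∑ x, (ω x a : ℂ) * torusChar k x‖ ^ 2 ∂(Measure.pi fun _ : TorusSite d L => ρ) ≤
      (L : ℝ) ^ d * ∫ ω, Real.exp (-β * vecGradForm (torusGraph d L) ω ω)
        ∂(Measure.pi fun _ : TorusSite d L => ρ) := by
  set Gr := torusGraph d L with hGr
  set μ₀ : Measure (TorusSite d L → Fin ν → ℝ) := Measure.pi fun _ : TorusSite d L => ρ with hμ₀
  have hL3 : 3 ≤ L := by omega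
  set ε : ℝ := dispersion (latticeMomentum L k) with hε'
  set h₁ : TorusSite d L → Fin ν → ℝ := planeField a (fun x => (torusChar k x).re) with hh₁
  set h₂ : TorusSite d L → Fin ν → ℝ := planeField a (fun x => (torusChar k x).im) with hh₂
  set w : (TorusSite d L → Fin ν → ℝ) → ℝ := fun ω => Real.exp (-β * vecGradForm Gr ω ω) with hw
  set A₁ : (TorusSite d L → Fin ν → ℝ) → ℝ := fun ω => vecGradForm Gr ω h₁ with hA₁
  set A₂ : (TorusSite d L → Fin ν → ℝ) → ℝ := fun ω => vecGradForm Gr ω h₂ with hA₂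
  set M : (TorusSite d L → Fin ν → ℝ) → ℂ := fun ω => ∑ x, (ω x a : ℂ) * torusChar k x with hM
  set Z₀ : ℝ := ∫ ω, w ω ∂μ₀ with hZ₀
  set X : ℝ := ∫ ω, w ω * ‖M ω‖ ^ 2 ∂μ₀ with hX
  show 4 * β * ε * X ≤ (L : ℝ) ^ d * Z₀
  have hGD : ∀ (h : TorusSite d L → Fin ν → ℝ) (t : ℝ), vZ Gr ρ β (t • h) ≤ vZ Gr ρ β 0 :=
    fun h t => vZ_le_vZ_zero hL hL4 ρ hKc hK hρ hβ.le _
  have key₁ : 2 * β * ∫ ω, w ω * A₁ ω ^ 2 ∂μ₀ ≤ vecGradForm Gr h₁ h₁ * Z₀ :=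
    integral_weight_vecGradForm_sq_le (G := Gr) ρ hKc hK hρ hβ h₁ (hGD h₁)
  have key₂ : 2 * β * ∫ ω, w ω * A₂ ω ^ 2 ∂μ₀ ≤ vecGradForm Gr h₂ h₂ * Z₀ :=
    integral_weight_vecGradForm_sq_le (G := Gr) ρ hKc hK hρ hβ h₂ (hGD h₂)
  -- `A₁² + A₂² = 4ε²‖M‖²`
  have hA : ∀ ω, A₁ ω ^ 2 + A₂ ω ^ 2 = 4 * ε ^ 2 * ‖M ω‖ ^ 2 := by
    intro ω
    have hC := gradFormC_torusChar_fun hL3 k (fun x => ω x a)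
    have hre : A₁ ω = 2 * ε * (M ω).re := by
      rw [hA₁, hM]
      simp only
      rw [hh₁, vecGradForm_planeField_right, ← gradFormC_re, hC, Complex.re_ofReal_mul]
    have him : A₂ ω = 2 * ε * (M ω).im := by
      rw [hA₂, hM]
      simp only
      rw [hh₂, vecGradForm_planeField_right, ← gradFormC_im, hC, Complex.im_ofReal_mul]
    rw [hre, him, ← Complex.normSq_eq_norm_sq, Complex.normSq_apply]
    ring
  -- `B₁ + B₂ = 2L^dε`
  have hB : vecGradForm Gr h₁ h₁ + vecGradForm Gr h₂ h₂ = 2 * (L : ℝ) ^ d * ε := by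
    rw [hh₁, hh₂, vecGradForm_planeField_self, vecGradForm_planeField_self, ← gradNormSq_eq,
      gradNormSq_torusChar hL3]
  -- add the two inequalities
  have hwc : Continuous w := ((continuous_vecGradForm_self (G := Gr)).const_mul (-β)).rexp
  have hA₁c : Continuous A₁ := continuous_vecGradForm_left (G := Gr) h₁
  have hA₂c : Continuous A₂ := continuous_vecGradForm_left (G := Gr) h₂
  have hMc : Continuous M := by rw [hM]; fun_prop
  have hint : ∀ {f : (TorusSite d L → Fin ν → ℝ) → ℝ}, Continuous f → Integrable f μ₀ := fun hf =>
    integrable_pi_of_continuous ρ hKc hK hf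
  have hS : ∫ ω, w ω * A₁ ω ^ 2 ∂μ₀ + ∫ ω, w ω * A₂ ω ^ 2 ∂μ₀ = 4 * ε ^ 2 * X := by
    rw [hX, ← integral_add (hint (by fun_prop)) (hint (by fun_prop)), ← integral_const_mul]
    refine integral_congr_ae (ae_of_all _ fun ω => ?_)
    simp only
    rw [← mul_add, hA ω]
    ring
  have hsum : 2 * β * (4 * ε ^ 2 * X) ≤ 2 * (L : ℝ) ^ d * ε * Z₀ := by
    calc 2 * β * (4 * ε ^ 2 * X)
        = 2 * β * ∫ ω, w ω * A₁ ω ^ 2 ∂μ₀ + 2 * β * ∫ ω, w ω * A₂ ω ^ 2 ∂μ₀ := by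
          rw [← hS, mul_add]
      _ ≤ vecGradForm Gr h₁ h₁ * Z₀ + vecGradForm Gr h₂ h₂ * Z₀ := add_le_add key₁ key₂
      _ = 2 * (L : ℝ) ^ d * ε * Z₀ := by rw [← add_mul, hB]
  have h8 : ε * (4 * β * ε * X) ≤ ε * ((L : ℝ) ^ d * Z₀) := by nlinarith
  exact le_of_mul_le_mul_left h8 hε

end PlaneWaves

/-! ### The torus model: Hamiltonian, Gibbs expectations, and the discharge -/

section TorusModel

open scoped ComplexConjugate

variable {d L ν : ℕ} [NeZero L]

/-- The Hamiltonian (10.38) is `β` times the vector bond form of the torus graph (`L ≥ 3`, each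
bond `{x, x + eᵢ}` counted once). [cite: FriedliVelenik2017, §10.5.1 eq. (10.38)] -/
theorem nVectorHamiltonian_eq_vecGradForm (hL : 3 ≤ L) (β : ℝ) (ω : VecConfig d L ν) :
    nVectorHamiltonian β ω = β * vecGradForm (torusGraph d L) ω ω := by
  unfold nVectorHamiltonian
  rw [vecGradForm_eq_sum, sum_edgeFinset_torusGraph hL]
  congr 1
  refine Finset.sum_congr rfl fun x _ => Finset.sum_congr rfl fun i _ => ?_
  simp only [Sym2.lift_mk]
  exact Finset.sum_congr rfl fun a _ => by ring

/-- **Gibbs expectations as weighted `μ₀`-averages**: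
`⟨F⟩_{L;β} = Z⁻¹ ∫ e^{-ℋ(ω)} F(ω) dμ₀(ω)` (Friedli–Velenik 2017, (10.5)). [cite: FriedliVelenik2017, §10.5.1] -/
theorem integral_nVectorGibbs (ρ : Measure (Fin ν → ℝ)) [IsFiniteMeasure ρ] (hρ : ρ ≠ 0)
    {β : ℝ} (hβ : 0 ≤ β) (F : VecConfig d L ν → ℝ) :
    ∫ ω, F ω ∂(nVectorGibbs (d := d) (L := L) ρ β) =
      (∫ ω, Real.exp (-nVectorHamiltonian β ω) * F ω ∂(nVectorRef (d := d) (L := L) ρ)) /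
        nVectorPartitionFunction (d := d) (L := L) ρ β := by
  have hZ := nVectorPartitionFunction_pos (d := d) (L := L) ρ hρ hβ
  have hmeas : Measurable fun ω : VecConfig d L ν =>
      ENNReal.ofReal (Real.exp (-nVectorHamiltonian β ω)) :=
    ((continuous_nVectorHamiltonian β).neg.rexp).measurable.ennreal_ofReal
  rw [nVectorGibbs, integral_smul_measure, integral_withDensity_eq_integral_toReal_smul hmeas
      (ae_of_all _ fun _ => ENNReal.ofReal_lt_top)]
  simp_rw [ENNReal.toReal_ofReal (Real.exp_pos _).le, smul_eq_mul]
  rw [ENNReal.toReal_inv, ENNReal.toReal_ofReal hZ.le, div_eq_inv_mul]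

/-- `‖∑_x ω_x^a χ_k(x)‖ = ‖(S^a)^(k)‖` (the two sums are complex conjugate). [folklore] -/
theorem norm_sum_mul_torusChar (ω : VecConfig d L ν) (k : TorusSite d L) (a : Fin ν) :
    ‖∑ x, (ω x a : ℂ) * torusChar k x‖ = ‖torusFourier (fun x => (ω x a : ℂ)) k‖ := by
  rw [sum_mul_torusChar_eq_conj_torusFourier (fun x => ω x a) k, Complex.norm_conj]

/-- The Fourier modes of a configuration depend continuously on it. [folklore] -/
@[fun_prop]
theorem continuous_torusFourier_apply (k : TorusSite d L) (a : Fin ν) :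
    Continuous fun ω : VecConfig d L ν => torusFourier (fun x => (ω x a : ℂ)) k := by
  unfold torusFourier
  fun_prop

/-- `spinFourierNormSq · k` is continuous. [folklore] -/
@[fun_prop]
theorem continuous_spinFourierNormSq (k : TorusSite d L) :
    Continuous fun ω : VecConfig d L ν => spinFourierNormSq ω k := by
  unfold spinFourierNormSq
  fun_prop

/-- `magnetisationNormSq` is continuous. [folklore] -/
@[fun_prop]
theorem continuous_magnetisationNormSq :
    Continuous fun ω : VecConfig d L ν => magnetisationNormSq ω := by
  unfold magnetisationNormSq
  fun_prop

/-- `|𝕋_L| = L^d`. [folklore] -/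
theorem card_torusSite_real : (Fintype.card (TorusSite d L) : ℝ) = (L : ℝ) ^ d := by
  rw [Fintype.card_fun, ZMod.card, Fintype.card_fin]
  push_cast
  rfl

/-- **Plancherel for unit spins** ((10.39) with `‖S_j‖₂ = 1`): `∑_k ‖Ŝ_k‖² = |𝕋_L|²`, i.e.
`∑_k spinFourierNormSq ω k = L^d · L^d` when every `‖ω_x‖₂ = 1`. [cite: FriedliVelenik2017, §10.5.2, eq. (10.39)] -/
theorem sum_spinFourierNormSq_eq (ω : VecConfig d L ν) (hω : ∀ x, ∑ a, ω x a ^ 2 = 1) :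
    ∑ k, spinFourierNormSq ω k = (L : ℝ) ^ d * (L : ℝ) ^ d := by
  unfold spinFourierNormSq
  rw [Finset.sum_comm]
  have hP : ∀ a : Fin ν, ∑ k, ‖torusFourier (fun x => (ω x a : ℂ)) k‖ ^ 2 =
      (L : ℝ) ^ d * ∑ x, ω x a ^ 2 := by
    intro a
    rw [torusFourier_plancherel_holds (d := d) (L := L) (fun x => (ω x a : ℂ))]
    congr 1
    exact Finset.sum_congr rfl fun x _ => by rw [Complex.norm_real, Real.norm_eq_abs, sq_abs]
  simp_rw [hP]
  rw [← Finset.mul_sum, Finset.sum_comm]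
  simp_rw [hω]
  rw [Finset.sum_const, Finset.card_univ, nsmul_eq_mul, mul_one, card_torusSite_real]

/-- The zero mode is the magnetisation: `‖Ŝ_0‖² = |𝕋_L|² ‖m_L‖²` (unnormalised:
`spinFourierNormSq ω 0 = L^{2d} ‖m_L‖²`). [cite: FriedliVelenik2017, §10.5.2] -/
theorem spinFourierNormSq_zero (ω : VecConfig d L ν) :
    spinFourierNormSq ω 0 = ((L : ℝ) ^ d) ^ 2 * magnetisationNormSq ω := by
  unfold spinFourierNormSq magnetisationNormSq
  rw [Finset.mul_sum]
  refine Finset.sum_congr rfl fun a _ => ?_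
  rw [torusFourier_apply_zero]
  have : ∑ x, ((ω x a : ℝ) : ℂ) = ((∑ x, ω x a : ℝ) : ℂ) := by push_cast; rfl
  rw [this, Complex.norm_real, Real.norm_eq_abs, sq_abs]
  have hL : (L : ℝ) ^ d ≠ 0 := pow_ne_zero _ (Nat.cast_ne_zero.2 (NeZero.ne L))
  field_simp

/-- **(10.40) in finite volume**: for unit spins,
`‖m_L‖² = 1 - |𝕋_L|⁻² ∑_{k ≠ 0} ‖∑_x e^{-ip·x} S_x‖²`. [cite: FriedliVelenik2017, §10.5.2, eq. (10.40)] -/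
theorem magnetisationNormSq_eq (ω : VecConfig d L ν) (hω : ∀ x, ∑ a, ω x a ^ 2 = 1) :
    magnetisationNormSq ω =
      1 - (1 / ((L : ℝ) ^ d)) ^ 2 * ∑ k ∈ Finset.univ.erase (0 : TorusSite d L),
        spinFourierNormSq ω k := by
  have htot := sum_spinFourierNormSq_eq ω hω
  rw [← Finset.add_sum_erase _ _ (Finset.mem_univ (0 : TorusSite d L)), spinFourierNormSq_zero] at htot
  have hL : (L : ℝ) ^ d ≠ 0 := pow_ne_zero _ (Nat.cast_ne_zero.2 (NeZero.ne L))
  field_simp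
  linear_combination htot

end TorusModel

end NVector

/-! ### The discharge -/

open NVector in
/-- **Infrared bound and finite-volume long-range order for `ν`-vector models, proved**
(Friedli–Velenik 2017, Thm. 10.24 and the display following it in §10.5.2; originally
Fröhlich–Simon–Spencer 1976, Thm. 3.1): the named fact `FriedliVelenik2017_nVector_infraredBound`
holds. Proof as printed in §10.5.3: Gaussian domination `Z(h) ≤ Z(0)` (Prop. 10.27) from the
reflection positivity of the product measure through bond-bisecting planes and the
Cauchy–Schwarz inequality for exponential kernels (Lemma 10.28, `NVector.kerInt_sq_le`,
`NVector.vZ_sq_le_reflect`) by descent on the number of bad bonds (`NVector.vZ_le_vZ_zero`); the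
second-order expansion (10.46)–(10.47) (`NVector.integral_weight_vecGradForm_sq_le`); plane waves
`h_j = e^{ip·j} e_ℓ` (`NVector.weighted_mode_bound`), summed over `ℓ`; and, for unit spins,
Plancherel (10.39)–(10.40) for the long-range-order clause. [cite: FriedliVelenik2017, Thm. 10.24 and §10.5.2–10.5.3] -/
theorem FriedliVelenik2017_nVector_infraredBound_holds : FriedliVelenik2017_nVector_infraredBound := by
  intro d L ν _ hL hL4 ρ _ hKex hρ β hβ
  obtain ⟨K, hKc, hK⟩ := hKex
  have hL3 : 3 ≤ L := by omega
  have hL0 : (0 : ℝ) < (L : ℝ) ^ d := pow_pos (Nat.cast_pos.2 (Nat.pos_of_ne_zero (NeZero.ne L))) d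
  set μ₀ : Measure (VecConfig d L ν) := nVectorRef (d := d) (L := L) ρ with hμ₀def
  have hμ₀pi : μ₀ = Measure.pi fun _ : TorusSite d L => ρ := rfl
  set Z : ℝ := nVectorPartitionFunction (d := d) (L := L) ρ β with hZdef
  have hZpos : 0 < Z := nVectorPartitionFunction_pos (d := d) (L := L) ρ hρ hβ.le
  set w : VecConfig d L ν → ℝ := fun ω => Real.exp (-nVectorHamiltonian β ω) with hw
  have hw_eq : ∀ ω, w ω = Real.exp (-β * vecGradForm (torusGraph d L) ω ω) := fun ω => by
    rw [hw]
    simp only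
    rw [nVectorHamiltonian_eq_vecGradForm hL3, neg_mul]
  have hZ_eq : Z = ∫ ω, w ω ∂μ₀ := rfl
  have hwc : Continuous w := (continuous_nVectorHamiltonian β).neg.rexp
  have hint : ∀ {f : VecConfig d L ν → ℝ}, Continuous f → Integrable f μ₀ := fun hf =>
    integrable_pi_of_continuous ρ hKc hK hf
  -- clause (1) in weighted form: `(1/L^d) ⟨‖Ŝ_k‖²⟩ ≤ ν/(4βε)`
  have clause1 : ∀ k : TorusSite d L, k ≠ 0 →
      (1 / (L : ℝ) ^ d) * ((∫ ω, w ω * spinFourierNormSq ω k ∂μ₀) / Z) ≤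
        ν / (4 * β * dispersion (latticeMomentum L k)) := by
    intro k hk
    set ε := dispersion (latticeMomentum L k) with hε
    have hεpos : 0 < ε := lt_of_le_of_ne (dispersion_nonneg _)
      (fun h => hk ((dispersion_latticeMomentum_eq_zero_iff_holds k).1 h.symm))
    -- per component (Thm. 10.24 for `S^a`), then summed over `a`
    have hcomp : ∀ a : Fin ν, 4 * β * ε *
        ∫ ω, w ω * ‖torusFourier (fun x => (ω x a : ℂ)) k‖ ^ 2 ∂μ₀ ≤ (L : ℝ) ^ d * Z := by
      intro a
      have h := weighted_mode_bound hL hL4 ρ hKc hK hρ hβ k hεpos a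
      rw [hZ_eq, hμ₀pi]
      simp_rw [hw_eq, ← norm_sum_mul_torusChar]
      exact h
    have hsum : 4 * β * ε * ∫ ω, w ω * spinFourierNormSq ω k ∂μ₀ ≤ ν * ((L : ℝ) ^ d * Z) := by
      have hsplit : ∫ ω, w ω * spinFourierNormSq ω k ∂μ₀ =
          ∑ a : Fin ν, ∫ ω, w ω * ‖torusFourier (fun x => (ω x a : ℂ)) k‖ ^ 2 ∂μ₀ := by
        unfold spinFourierNormSq
        simp_rw [Finset.mul_sum]
        rw [integral_finsetSum _ fun a _ => hint (by fun_prop)]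
      rw [hsplit, Finset.mul_sum]
      calc ∑ a : Fin ν, 4 * β * ε * ∫ ω, w ω * ‖torusFourier (fun x => (ω x a : ℂ)) k‖ ^ 2 ∂μ₀
          ≤ ∑ _a : Fin ν, (L : ℝ) ^ d * Z := Finset.sum_le_sum fun a _ => hcomp a
        _ = ν * ((L : ℝ) ^ d * Z) := by
            rw [Finset.sum_const, Finset.card_univ, Fintype.card_fin, nsmul_eq_mul]
    rw [div_mul_div_comm, one_mul, div_le_div_iff₀ (by positivity) (by positivity)]
    linarith [hsum]
  refine ⟨fun k hk => ?_, fun hnorm => ?_⟩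
  · rw [integral_nVectorGibbs ρ hρ hβ.le]
    exact clause1 k hk
  · -- clause (2): Plancherel for unit spins, (10.39)–(10.40)
    have hae : ∀ᵐ ω ∂μ₀, ∀ x, ∑ a, ω x a ^ 2 = 1 :=
      ae_pi_forall (ι := TorusSite d L) ρ hnorm
    have hmag : ∫ ω, w ω * magnetisationNormSq ω ∂μ₀ =
        Z - (1 / (L : ℝ) ^ d) ^ 2 * ∑ k ∈ Finset.univ.erase (0 : TorusSite d L),
          ∫ ω, w ω * spinFourierNormSq ω k ∂μ₀ := by
      have h1 : ∫ ω, w ω * magnetisationNormSq ω ∂μ₀ =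
          ∫ ω, (w ω - (1 / (L : ℝ) ^ d) ^ 2 * ∑ k ∈ Finset.univ.erase (0 : TorusSite d L),
            w ω * spinFourierNormSq ω k) ∂μ₀ := by
        refine integral_congr_ae ?_
        filter_upwards [hae] with ω hω
        rw [magnetisationNormSq_eq ω hω, mul_sub, mul_one, Finset.mul_sum, Finset.mul_sum,
          Finset.mul_sum]
        congr 1
        exact Finset.sum_congr rfl fun k _ => by ring
      have h2 : Integrable (fun ω => (1 / (L : ℝ) ^ d) ^ 2 *
          ∑ k ∈ Finset.univ.erase (0 : TorusSite d L), w ω * spinFourierNormSq ω k) μ₀ :=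
        hint (by fun_prop)
      rw [h1, integral_sub (hint (by fun_prop)) h2, integral_const_mul,
        integral_finsetSum _ fun k _ => hint (by fun_prop), hZ_eq]
    have hbound : ∑ k ∈ Finset.univ.erase (0 : TorusSite d L),
        (1 / (L : ℝ) ^ d) ^ 2 * (∫ ω, w ω * spinFourierNormSq ω k ∂μ₀) / Z ≤
          ν / (4 * β) * ((1 / (L : ℝ) ^ d) *
            ∑ k ∈ Finset.univ.erase (0 : TorusSite d L), 1 / dispersion (latticeMomentum L k)) := by
      rw [Finset.mul_sum, Finset.mul_sum]
      refine Finset.sum_le_sum fun k hkT => ?_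
      have hk : k ≠ 0 := Finset.ne_of_mem_erase hkT
      have h1 := clause1 k hk
      have e1 : (1 / (L : ℝ) ^ d) ^ 2 * (∫ ω, w ω * spinFourierNormSq ω k ∂μ₀) / Z =
          (1 / (L : ℝ) ^ d) * (1 / (L : ℝ) ^ d * ((∫ ω, w ω * spinFourierNormSq ω k ∂μ₀) / Z)) := by
        ring
      have e2 : (ν : ℝ) / (4 * β) * (1 / (L : ℝ) ^ d * (1 / dispersion (latticeMomentum L k))) =
          (1 / (L : ℝ) ^ d) * (ν / (4 * β * dispersion (latticeMomentum L k))) := by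
        ring
      rw [e1, e2]
      exact mul_le_mul_of_nonneg_left h1 (by positivity)
    calc 1 - ν / (4 * β) * ((1 / (L : ℝ) ^ d) *
          ∑ k ∈ Finset.univ.erase (0 : TorusSite d L), 1 / dispersion (latticeMomentum L k))
        ≤ 1 - ∑ k ∈ Finset.univ.erase (0 : TorusSite d L),
            (1 / (L : ℝ) ^ d) ^ 2 * (∫ ω, w ω * spinFourierNormSq ω k ∂μ₀) / Z := by linarith
      _ = (∫ ω, w ω * magnetisationNormSq ω ∂μ₀) / Z := by
          rw [hmag, sub_div, div_self hZpos.ne', Finset.mul_sum, Finset.sum_div]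
      _ = ∫ ω, magnetisationNormSq ω ∂(nVectorGibbs (d := d) (L := L) ρ β) :=
          (integral_nVectorGibbs ρ hρ hβ.le _).symm

end Literature.Probability.LatticeModels
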